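import Literature.AlgebraicGeometry.Motives.AbelianVarietyDihedralOrderEightBrauerRelations
import HarnessLib

/-!
# The Brauer relation lattice of the dihedral group `D_8` of order `16 = 2⁴` in full: rank `5`, Tornehave–Bouc
# generators, and Bartel–Dokchitser's `Prim(D_{16}) = ℤ/2ℤ` made concrete — the second instance of Theorem A, Case 1

Layer A1/A2 of the Hodge foundations lane (`lit-hodgefound`, row A1-20⁺ · A2, seat p03 generation 28, row g28-#5) on
the ALGEBRAIC carrier; sequel of `Motives/AbelianVarietyDihedralOrderEightBrauerRelations` (g28-#2: `K(D_4)` in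
full, `Prim(D_4) = ℤ/2ℤ` — the case `2^n = 8` of Theorem A (1); same method, CONSUMED: the marks dictionary
`indClassFun_one_apply_eq_div`, `card_conj_mem_bot`, `indClassFun_top_one`, `mem_ker_linearCombination_indClassFun_one_iff`,
the engine `sum_mul_finrank_hom_eq_of_sum_smul_indClassFun_one_eq`, `finrank_hom_biprod`, `dim_biprod`,
`isIsogenous_iff_forall_finrank_hom_eq'`) and of `Motives/AbelianVarietyDihedralCentralKleinBrauerRelation` (g28-#1:
`conj_tau_eq_tau_iff_mem_centralKlein` makes the Klein four-subgroups `K = ⟨τ, σ⁴⟩`, `K' = ⟨στ, σ⁴⟩` decidable; its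
`dihedralGroup_isIsogenous_centralKlein 2` is the Kani–Rosen isogeny of `Θ_dih` below — not restated) and of
`GroupTheory/SpecificGroups/DihedralEvenSubgroups` §5 (the model lemmas `DihedralEven.dihedralGroup_eight_orderOf_r_one`,
`dihedralGroup_eight_card` — CONSUMED).  Here the
dihedral group `D_8` of order `16` on Mathlib's `DihedralGroup 8` (`σ = r 1`, `τ = sr 0`, `στ = sr 7`): the ELEVEN
classes of subgroups `1, Z = ⟨σ⁴⟩, ⟨σ²⟩, ⟨σ⟩, ⟨τ⟩, ⟨στ⟩, K, K', D = ⟨τ, σ²⟩, D' = ⟨στ, σ²⟩, D_8`, all their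
permutation characters as explicit functions (§2, marks by `decide`), the six class equations solved (§3:
**`a ∈ K(D_8)` iff `a_1 = −a_Z − a_{σ²} − a_σ`, `a_τ = a_σ − a_K − a_D`, `a_{στ} = a_σ + 2a_Z + 2a_{σ²} + a_K + a_D`,
`a_{K'} = −2a_Z − a_K`, `a_{D'} = −2a_{σ²} − a_D`, `a_G = −2a_σ`**), hence (§4) **`rank K(D_8) = 5`** (= the five
classes of non-cyclic subgroups, Bartel–Dokchitser §2) with basis **`Θ_dih = ⟨τ⟩ − ⟨στ⟩ − K + K'`** (Theorem A Case 1),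
**`Inf Θ_dih(D_4) = K − K' − D + D'`**, the `C_2 × C_2` lift **`⟨σ²⟩ − ⟨σ⟩ − D − D' + 2G`**, **`Z − ⟨σ²⟩ − 2K' + 2D'`**,
**`Ind_{K'} = 1 − Z − 2⟨στ⟩ + 2K'`**; and TORNEHAVE–BOUC / THEOREM A CASE 1 MADE CONCRETE: the span `Imprim` of the
six relations lifted from `D_8/Z ≅ D_4` and `D_8/⟨σ²⟩ ≅ C_2²` or induced from `D, D', K, K'` (`Inf Θ_dih(D_4)`, the
`C_2²` lift, `Z − ⟨σ²⟩ − 2K + 2D`, `Z − ⟨σ²⟩ − 2K' + 2D'`, `Ind_K`, `Ind_{K'}`) does NOT contain `Θ_dih` (the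
functional `a_σ + a_K + a_D` is even on it, `−1` on `Θ_dih`), `2Θ_dih = Ind_{K'} − Ind_K ∈ Imprim`, and
`K(D_8) = ℤΘ_dih + Imprim`: **`Prim(D_{16}) ≅ ℤ/2ℤ` generated by `Θ_dih`**.  §5: the Kani–Rosen isogeny
`B_K × B_{D'} ∼ B_{K'} × B_D` of the lifted dihedral relation.  Everything here is PROVED; NO definition, NO named
fact (net Literature debt 0).

## Sources, verbatim

A. Bartel, T. Dokchitser, *Brauer relations in finite groups*, J. Eur. Math. Soc. **17** (2015) (arXiv 1103.2047, held
`paper:arxiv-1103.2047`).  Theorem A (p0003): "A finite non-cyclic group `G` has a primitive relation if and only if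
either (1) `G` is dihedral of order `2^n ≥ 8` […] Case 1: `Prim(G) = ℤ/2ℤ`, basis `Θ = H − H' + ZH' − ZH`, `H ≅ C_2`
and `H' ≅ C_2` are non-conjugate non-central, `Z = Z(G) ≅ C_2`."  §2 (p0006): "Induction. […] Inflation. If
`G ≅ G̃/N`, then each `H_i` corresponds to a subgroup `H̃_i` of `G̃` containing `N`, and, inflating the permutation
representations from a quotient, we see that `Θ̃ = Σ_i n_i H̃_i` is a `G̃`-relation."; "the rank of `K(G)` is the
number of conjugacy classes of non-cyclic subgroups"; Example 3 (`C_p × C_p`: "It is generated by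
`Θ = 1 − Σ_C C + pG`").  §3 Remark 2 (p0007): induced terms "might represent the “wrong” `D`-conjugacy classes".
§5 Theorem 4 (Tornehave–Bouc) (p0010): "All Brauer relations in `p`-groups are `ℤ`-linear combinations of ones
lifted from subquotients `P` of the following types: (1) `P ≅ C_p × C_p` with the relation `1 − Σ_C C + p·P` […];
(3) `P ≅ D_{2^n}`, and the relation is `I − IZ − J + JZ` where `Z = Z(P)` and `I` and `J` are two non-conjugate
non-central subgroups of order `2`"; its proof: "if `P` is dihedral, then there are two conjugacy classes of
non-trivial subgroups that do not contain `C_2`, represented, say, by `I` and `J`. […] In the resulting relation,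
every subgroup will either contain `C_2` or will be contained in `D = C_2 × J`, which is a proper subgroup of `P`.
[…] the group of primitive relations of `P` is generated by the relation of (3)".  E. Kani, M. Rosen, Math. Ann.
**284** (1989), Thm. 3; V. Dokchitser, H. Green, A. Konstantinou, A. Morgan, arXiv:2211.06357, §1.3 Thm. 1.3.

## Dictionary and what is proved (namespace `Literature.AlgebraicGeometry.Motives.AbelianVariety`)

Representatives (indices `0…10`): `![⊥, zpowers ((r 1)^4), zpowers ((r 1)^2), zpowers (r 1), zpowers (sr 0),
zpowers (r 1 * sr 0), zpowers (sr 0) ⊔ zpowers ((r 1)^4), zpowers (r 1 * sr 0) ⊔ zpowers ((r 1)^4),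
zpowers (sr 0) ⊔ zpowers ((r 1)^2), zpowers (r 1 * sr 0) ⊔ zpowers ((r 1)^2), ⊤]`
= `![1, Z, ⟨σ²⟩, ⟨σ⟩, ⟨τ⟩, ⟨στ⟩, K, K', D, D', G]`; `𝒦` any `Submodule ℤ (Fin 11 → ℤ)` with
`a ∈ 𝒦 ↔ Σ_i a_i (1_{H_i})^G = 0`; classes described by `∃ k : ZMod 8, g = r (2k)` (even rotations), `g = r k`,
`g = sr (2k)` (even reflections), `g = sr (2k+1)` (odd reflections).

* §1 `dihedralGroup_eight_cases`, `dihedralGroup_eight_orderOf_r_four/_r_two`, `mem_kleinTau_eight_iff`,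
  `mem_kleinMul_eight_iff` (`x ∈ K ↔ x⁻¹τx = τ`), **`mem_dihedralTau_eight_iff`**, `mem_dihedralMul_eight_iff`
  (`x ∈ D ↔ x = τ^a σ^{2b}`).
* §2 `card_conj_mem_*_dihedralEight` (nine marks functions), `natCard_subgroups_dihedralEight`,
  **`indClassFun_one_apply_dihedralEight`** (the eleven permutation characters).
* §3 `sum_smul_indClassFun_dihedralEight_apply`, **`sum_smul_indClassFun_dihedralEight_eq_zero_iff`**, the seven
  relations `thetaDih/infDih/infKlein/infInd/infInd'/indKlein/indKlein'_mem_dihedralEight`,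
  **`two_smul_thetaDih_eq_dihedralEight`** (`2Θ_dih = Ind_{K'} − Ind_K`).
* §4 `mem_brauerRelations_dihedralEight_iff`, `*_mem_brauerRelations_dihedralEight`,
  **`eq_combination_of_mem_brauerRelations_dihedralEight`**, **`brauerRelations_dihedralEight_eq_span`**,
  `linearIndependent_basis_dihedralEight`,
  **`thetaDih_not_mem_span_imprimitive_dihedralEight`**, **`two_smul_thetaDih_mem_span_imprimitive_dihedralEight`**,
  `span_imprimitive_le_brauerRelations_dihedralEight`, **`brauerRelations_dihedralEight_eq_span_thetaDih_sup_imprimitive`**,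
  `ker_linearCombination_indClassFun_one_dihedralEight_eq_span`, **`finrank_ker_linearCombination_indClassFun_one_dihedralEight`** (`= 5`).
* §5 `indClassFun_kleinTau_add_dihedralMul_eq_dihedralEight` (`(1_K)^G + (1_{D'})^G = (1_{K'})^G + (1_D)^G`),
  **`finrank_hom_infDih_dihedralEight`**, **`isIsogenous_infDih_dihedralEight`** (`B_K ⊞ B_{D'} ∼ B_{K'} ⊞ B_D`),
  `dim_infDih_dihedralEight`.

Honest scope (stated, not hidden).  "Imprimitive" is the explicit span of the six listed lifted/induced relations
of the proper subquotients of `D_8` — complete by Theorem 4 and the tree's `K(D_4)` (g28-#2: three generators,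
whose lifts are `infDih`, `infKlein`, `infInd`), `K(C_2 × C_2) = ℤΘ` (Example 3), `K(cyclic) = 0`, the inductions
from the two `D_4`'s and the two Klein fours reducing to the listed vectors and `infInd` (this bookkeeping is argued
here in words, not by a Lean `Prim` functor); only `2^n = 16` (with g28-#2, `2^n = 8`), not general `D_{2^n}`.

## References

* [BartelDokchitser2015] A. Bartel, T. Dokchitser, *Brauer relations in finite groups*, JEMS 17 (2015), §1.1 Theorem A
  (1) Case 1, §2, §3 Remark 2, §5 Theorem 4 (Tornehave–Bouc).
* [KaniRosen1989] E. Kani, M. Rosen, *Idempotent relations and factors of Jacobians*, Math. Ann. 284 (1989), Thm. 3.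
* [DokchitserEtAl2022] V. Dokchitser, H. Green, A. Konstantinou, A. Morgan, *Parity of ranks of Jacobians of curves*,
  arXiv:2211.06357, §1.3 Thm. 1.3.
-/

noncomputable section

universe u

open CategoryTheory CategoryTheory.Limits
open Literature.RepresentationTheory.FiniteGroups
open Literature.GroupTheory.SpecificGroups

namespace Literature.AlgebraicGeometry.Motives

namespace AbelianVariety

open DihedralGroup

/-! ## §1 `D_8 = DihedralGroup 8` (order 16): `σ = r 1`, `τ = sr 0`, `στ = sr 7`, `Z = ⟨σ⁴⟩`; the seven classes;
decidable membership in the eleven representative subgroups -/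

section DihedralEightGroup

/-- `|D_8| = 16`. [cite: BartelDokchitser2015, §1.1 Theorem A (1) ("dihedral of order 2^n ≥ 8")] -/
theorem card_dihedralGroup_eight : Fintype.card (DihedralGroup 8) = 16 := by
  rw [← Nat.card_eq_fintype_card, nat_card]

/-- `(r 1)⁴ = r 4`, `(r 1)² = r 2`, `r 1 · sr 0 = sr 7` (`σ⁴ = Z(G)`-generator, `σ²`, `στ`). [cite: BartelDokchitser2015, §1.1 Theorem A Case 1 ("Z = Z(G) ≅ C_2", "H' ≅ C_2")] -/
theorem dihedralGroup_eight_pow_mul :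
    (r 1 : DihedralGroup 8) ^ 4 = r 4 ∧ (r 1 : DihedralGroup 8) ^ 2 = r 2 ∧ (r 1 : DihedralGroup 8) * sr 0 = sr 7 := by
  refine ⟨by decide, by decide, by decide⟩

/-- `orderOf (r 4) = 2` (the central involution). [cite: BartelDokchitser2015, §1.1 Theorem A Case 1 ("Z = Z(G) ≅ C_2")] -/
theorem dihedralGroup_eight_orderOf_r_four : orderOf (r 4 : DihedralGroup 8) = 2 := by
  rw [orderOf_eq_prime_iff (p := 2)]
  decide

/-- `orderOf (r 2) = 4` (`σ²` generates the cyclic subgroup of index `4`). [cite: BartelDokchitser2015, §5 Proposition 4 ("D_{2^{n+1}} = ⟨c, x | c^{2^n} = x² = 1, xcx = c⁻¹⟩")] -/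
theorem dihedralGroup_eight_orderOf_r_two : orderOf (r 2 : DihedralGroup 8) = 4 := by
  rw [orderOf_eq_iff (by norm_num)]
  decide

/-- `orderOf (sr 7) = 2` (`στ` is a non-central involution). [cite: BartelDokchitser2015, §1.1 Theorem A Case 1 ("H' ≅ C_2 … non-central")] -/
theorem dihedralGroup_eight_orderOf_sr_seven : orderOf (sr 7 : DihedralGroup 8) = 2 := orderOf_sr 7

/-- **The seven conjugacy classes of `D_8`**: `{1}`, `{σ⁴}`, `{σ², σ⁶}`, `{σ, σ⁷}`, `{σ³, σ⁵}`, the even reflections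
`{τ, σ²τ, σ⁴τ, σ⁶τ}`, the odd reflections — every element is one of `r 0, …, r 7, sr 0, …, sr 7` ("two conjugacy
classes of non-trivial subgroups that do not contain `C_2`, represented, say, by `I` and `J`"). [cite: BartelDokchitser2015, §5 proof of Theorem 4] -/
theorem dihedralGroup_eight_cases (g : DihedralGroup 8) :
    g = 1 ∨ g = r 4 ∨ (g = r 2 ∨ g = r 6) ∨ (g = r 1 ∨ g = r 3 ∨ g = r 5 ∨ g = r 7) ∨
      (g = sr 0 ∨ g = sr 2 ∨ g = sr 4 ∨ g = sr 6) ∨ (g = sr 1 ∨ g = sr 3 ∨ g = sr 5 ∨ g = sr 7) := by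
  revert g
  decide

/-- `x ∈ ⟨r 4⟩ ↔ x ∈ {(r 4)^k : k < 2}`. [folklore] -/
private theorem mem_zpowers_r_four_iff (x : DihedralGroup 8) :
    x ∈ Subgroup.zpowers ((r 1 : DihedralGroup 8) ^ 4) ↔ x ∈ (Finset.range 2).image ((r 4 : DihedralGroup 8) ^ ·) := by
  rw [dihedralGroup_eight_pow_mul.1, mem_zpowers_iff_mem_range_orderOf, dihedralGroup_eight_orderOf_r_four]

/-- `x ∈ ⟨r 2⟩ ↔ x ∈ {(r 2)^k : k < 4}`. [folklore] -/
private theorem mem_zpowers_r_two_iff (x : DihedralGroup 8) :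
    x ∈ Subgroup.zpowers ((r 1 : DihedralGroup 8) ^ 2) ↔ x ∈ (Finset.range 4).image ((r 2 : DihedralGroup 8) ^ ·) := by
  rw [dihedralGroup_eight_pow_mul.2.1, mem_zpowers_iff_mem_range_orderOf, dihedralGroup_eight_orderOf_r_two]

/-- `x ∈ ⟨r 1⟩ ↔ x ∈ {(r 1)^k : k < 8}`. [folklore] -/
private theorem mem_zpowers_r_one_iff (x : DihedralGroup 8) :
    x ∈ Subgroup.zpowers (r 1 : DihedralGroup 8) ↔ x ∈ (Finset.range 8).image ((r 1 : DihedralGroup 8) ^ ·) := by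
  rw [mem_zpowers_iff_mem_range_orderOf, orderOf_r_one]

/-- `x ∈ ⟨sr 0⟩ ↔ x ∈ {(sr 0)^k : k < 2}`. [folklore] -/
private theorem mem_zpowers_sr_zero_iff (x : DihedralGroup 8) :
    x ∈ Subgroup.zpowers (sr 0 : DihedralGroup 8) ↔ x ∈ (Finset.range 2).image ((sr 0 : DihedralGroup 8) ^ ·) := by
  rw [mem_zpowers_iff_mem_range_orderOf, orderOf_sr]

/-- `x ∈ ⟨r 1 · sr 0⟩ ↔ x ∈ {(sr 7)^k : k < 2}`. [folklore] -/
private theorem mem_zpowers_mul_iff (x : DihedralGroup 8) :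
    x ∈ Subgroup.zpowers ((r 1 : DihedralGroup 8) * sr 0) ↔ x ∈ (Finset.range 2).image ((sr 7 : DihedralGroup 8) ^ ·) := by
  rw [dihedralGroup_eight_pow_mul.2.2, mem_zpowers_iff_mem_range_orderOf, orderOf_sr]

/-- **`x ∈ K = ⟨τ⟩ ⊔ ⟨σ⁴⟩ ↔ x⁻¹ τ x = τ`** (`K` is the centraliser of `τ`; g28-#1). [cite: BartelDokchitser2015, §1.1 Theorem A Case 1 ("ZH")] -/
theorem mem_kleinTau_eight_iff (x : DihedralGroup 8) :
    x ∈ (Subgroup.zpowers (sr 0 : DihedralGroup 8) ⊔ Subgroup.zpowers ((r 1 : DihedralGroup 8) ^ 4)) ↔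
      x⁻¹ * sr 0 * x = sr 0 :=
  (conj_tau_eq_tau_iff_mem_centralKlein DihedralEven.dihedralGroup_eight_orderOf_r_one (by decide) (orderOf_sr 0)
    dihedralGroup_sr_conj_r DihedralEven.dihedralGroup_eight_card x).symm

/-- **`x ∈ K' = ⟨στ⟩ ⊔ ⟨σ⁴⟩ ↔ x⁻¹ (sr 7) x = sr 7`.** [cite: BartelDokchitser2015, §1.1 Theorem A Case 1 ("ZH'")] -/
theorem mem_kleinMul_eight_iff (x : DihedralGroup 8) :
    x ∈ (Subgroup.zpowers ((r 1 : DihedralGroup 8) * sr 0) ⊔ Subgroup.zpowers ((r 1 : DihedralGroup 8) ^ 4)) ↔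
      x⁻¹ * sr 7 * x = sr 7 := by
  rw [← dihedralGroup_eight_pow_mul.2.2]
  exact (conj_tau_eq_tau_iff_mem_centralKlein DihedralEven.dihedralGroup_eight_orderOf_r_one (by decide)
    (DihedralTwiceOdd.orderOf_mul DihedralEven.dihedralGroup_eight_orderOf_r_one (by decide) (orderOf_sr 0)
      dihedralGroup_sr_conj_r)
    (DihedralTwiceOdd.mul_conj_eq_inv dihedralGroup_sr_conj_r)
    DihedralEven.dihedralGroup_eight_card x).symm

/-- `⟨σ²⟩ ⊴ D_8`. [folklore] -/
private theorem normal_zpowers_r_two : (Subgroup.zpowers ((r 1 : DihedralGroup 8) ^ 2)).Normal := by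
  refine ⟨fun n hn g ↦ ?_⟩
  rw [mem_zpowers_r_two_iff] at hn ⊢
  revert hn
  revert n g
  decide

/-- **`x ∈ D = ⟨τ⟩ ⊔ ⟨σ²⟩` (dihedral of order `8`, index `2`) ↔ `x = τ^a σ^{2b}` for some `a < 2`, `b < 4`.**
[cite: BartelDokchitser2015, §5 proof of Theorem 4 ("D = C_2 × J, which is a proper subgroup of P" pattern: the index-2 dihedral subgroups)] -/
theorem mem_dihedralTau_eight_iff (x : DihedralGroup 8) :
    x ∈ (Subgroup.zpowers (sr 0 : DihedralGroup 8) ⊔ Subgroup.zpowers ((r 1 : DihedralGroup 8) ^ 2)) ↔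
      ∃ h ∈ (Finset.range 2).image ((sr 0 : DihedralGroup 8) ^ ·),
        ∃ n ∈ (Finset.range 4).image ((r 2 : DihedralGroup 8) ^ ·), h * n = x := by
  haveI := normal_zpowers_r_two
  rw [Subgroup.mem_sup_of_normal_right]
  simp only [mem_zpowers_sr_zero_iff, mem_zpowers_r_two_iff]

/-- **`x ∈ D' = ⟨στ⟩ ⊔ ⟨σ²⟩ ↔ x = (στ)^a σ^{2b}`, `a < 2`, `b < 4`.** [cite: BartelDokchitser2015, §5 proof of Theorem 4] -/
theorem mem_dihedralMul_eight_iff (x : DihedralGroup 8) :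
    x ∈ (Subgroup.zpowers ((r 1 : DihedralGroup 8) * sr 0) ⊔ Subgroup.zpowers ((r 1 : DihedralGroup 8) ^ 2)) ↔
      ∃ h ∈ (Finset.range 2).image ((sr 7 : DihedralGroup 8) ^ ·),
        ∃ n ∈ (Finset.range 4).image ((r 2 : DihedralGroup 8) ^ ·), h * n = x := by
  haveI := normal_zpowers_r_two
  rw [Subgroup.mem_sup_of_normal_right]
  simp only [mem_zpowers_mul_iff, mem_zpowers_r_two_iff]

end DihedralEightGroup

/-! ## §2 The marks of the eleven representative subgroups, machine-checked -/

section DihedralEightMarks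

/-- `|{x : Q x}|` as a filter cardinality. [folklore] -/
private theorem natCard_subtype_eq_card_filter_d8 (P : DihedralGroup 8 → Prop) [DecidablePred P]
    (Q : DihedralGroup 8 → Prop) (hQP : ∀ x, Q x ↔ P x) :
    Nat.card {x : DihedralGroup 8 // Q x} = (Finset.univ.filter P).card := by
  rw [← Fintype.card_subtype, ← Nat.card_eq_fintype_card]
  exact Nat.card_congr (Equiv.subtypeEquivRight hQP)

/-- Marks of the three non-trivial cyclic rotation subgroups (normal: `16·[g ∈ H]`), machine-checked. [folklore] -/
private theorem marks_table_rot_eight (g : DihedralGroup 8) :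
    ((Finset.univ.filter fun x : DihedralGroup 8 ↦
        x⁻¹ * g * x ∈ (Finset.range 2).image ((r 4 : DihedralGroup 8) ^ ·)).card =
      (if g = 1 ∨ g = r 4 then 16 else 0)) ∧
    ((Finset.univ.filter fun x : DihedralGroup 8 ↦
        x⁻¹ * g * x ∈ (Finset.range 4).image ((r 2 : DihedralGroup 8) ^ ·)).card =
      (if ∃ k : ZMod 8, g = r (2 * k) then 16 else 0)) ∧
    ((Finset.univ.filter fun x : DihedralGroup 8 ↦
        x⁻¹ * g * x ∈ (Finset.range 8).image ((r 1 : DihedralGroup 8) ^ ·)).card =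
      (if ∃ k : ZMod 8, g = r k then 16 else 0)) := by
  revert g
  decide

/-- Marks of `⟨τ⟩, ⟨στ⟩, K, K'`, machine-checked. [folklore] -/
private theorem marks_table_refl_eight (g : DihedralGroup 8) :
    ((Finset.univ.filter fun x : DihedralGroup 8 ↦
        x⁻¹ * g * x ∈ (Finset.range 2).image ((sr 0 : DihedralGroup 8) ^ ·)).card =
      (if g = 1 then 16 else if ∃ k : ZMod 8, g = sr (2 * k) then 4 else 0)) ∧
    ((Finset.univ.filter fun x : DihedralGroup 8 ↦
        x⁻¹ * g * x ∈ (Finset.range 2).image ((sr 7 : DihedralGroup 8) ^ ·)).card =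
      (if g = 1 then 16 else if ∃ k : ZMod 8, g = sr (2 * k + 1) then 4 else 0)) ∧
    ((Finset.univ.filter fun x : DihedralGroup 8 ↦ (x⁻¹ * g * x)⁻¹ * sr 0 * (x⁻¹ * g * x) = sr 0).card =
      (if g = 1 ∨ g = r 4 then 16 else if ∃ k : ZMod 8, g = sr (2 * k) then 8 else 0)) ∧
    ((Finset.univ.filter fun x : DihedralGroup 8 ↦ (x⁻¹ * g * x)⁻¹ * sr 7 * (x⁻¹ * g * x) = sr 7).card =
      (if g = 1 ∨ g = r 4 then 16 else if ∃ k : ZMod 8, g = sr (2 * k + 1) then 8 else 0)) := by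
  revert g
  decide

end DihedralEightMarks

section DihedralEightCharacters

/-- **Marks of `Z = ⟨σ⁴⟩`**: `16·[g ∈ Z]`. [cite: BartelDokchitser2015, §1.1 Theorem A Case 1 ("Z = Z(G) ≅ C_2")] -/
theorem card_conj_mem_center_dihedralEight (g : DihedralGroup 8) :
    Nat.card {x : DihedralGroup 8 // x⁻¹ * g * x ∈ Subgroup.zpowers ((r 1 : DihedralGroup 8) ^ 4)} =
      if g = 1 ∨ g = r 4 then 16 else 0 := by
  classical
  rw [natCard_subtype_eq_card_filter_d8 _ _ fun x ↦ mem_zpowers_r_four_iff _]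
  exact (marks_table_rot_eight g).1

/-- **Marks of `⟨σ²⟩`**: `16·[g ∈ ⟨σ²⟩]` (normal). [cite: BartelDokchitser2015, §1.1 ("Θ ∈ K(G) ⟺ Σ_i n_i Ind 1_{H_i} = 0"); §5 Proposition 4] -/
theorem card_conj_mem_zpowers_sq_dihedralEight (g : DihedralGroup 8) :
    Nat.card {x : DihedralGroup 8 // x⁻¹ * g * x ∈ Subgroup.zpowers ((r 1 : DihedralGroup 8) ^ 2)} =
      if ∃ k : ZMod 8, g = r (2 * k) then 16 else 0 := by
  classical
  rw [natCard_subtype_eq_card_filter_d8 _ _ fun x ↦ mem_zpowers_r_two_iff _]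
  exact (marks_table_rot_eight g).2.1

/-- **Marks of `⟨σ⟩`**: `16·[g ∈ ⟨σ⟩]` (normal). [cite: BartelDokchitser2015, §1.1; §5 Proposition 4 ("c^{2^n} = 1")] -/
theorem card_conj_mem_zpowers_r_one_dihedralEight (g : DihedralGroup 8) :
    Nat.card {x : DihedralGroup 8 // x⁻¹ * g * x ∈ Subgroup.zpowers (r 1 : DihedralGroup 8)} =
      if ∃ k : ZMod 8, g = r k then 16 else 0 := by
  classical
  rw [natCard_subtype_eq_card_filter_d8 _ _ fun x ↦ mem_zpowers_r_one_iff _]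
  exact (marks_table_rot_eight g).2.2

/-- **Marks of `⟨τ⟩`**: `16` at `1`, `4` on the even reflections, `0` elsewhere. [cite: BartelDokchitser2015, §1.1 Theorem A Case 1 ("H ≅ C_2 … non-central")] -/
theorem card_conj_mem_zpowers_sr_zero_dihedralEight (g : DihedralGroup 8) :
    Nat.card {x : DihedralGroup 8 // x⁻¹ * g * x ∈ Subgroup.zpowers (sr 0 : DihedralGroup 8)} =
      if g = 1 then 16 else if ∃ k : ZMod 8, g = sr (2 * k) then 4 else 0 := by
  classical
  rw [natCard_subtype_eq_card_filter_d8 _ _ fun x ↦ mem_zpowers_sr_zero_iff _]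
  exact (marks_table_refl_eight g).1

/-- **Marks of `⟨στ⟩`**: `16` at `1`, `4` on the odd reflections. [cite: BartelDokchitser2015, §1.1 Theorem A Case 1 ("H' ≅ C_2 … non-conjugate")] -/
theorem card_conj_mem_zpowers_mul_dihedralEight (g : DihedralGroup 8) :
    Nat.card {x : DihedralGroup 8 // x⁻¹ * g * x ∈ Subgroup.zpowers ((r 1 : DihedralGroup 8) * sr 0)} =
      if g = 1 then 16 else if ∃ k : ZMod 8, g = sr (2 * k + 1) then 4 else 0 := by
  classical
  rw [natCard_subtype_eq_card_filter_d8 _ _ fun x ↦ mem_zpowers_mul_iff _]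
  exact (marks_table_refl_eight g).2.1

/-- **Marks of `K = ⟨τ, σ⁴⟩`**: `16` on `Z`, `8` on the even reflections. [cite: BartelDokchitser2015, §1.1 Theorem A Case 1 ("ZH")] -/
theorem card_conj_mem_kleinTau_dihedralEight (g : DihedralGroup 8) :
    Nat.card {x : DihedralGroup 8 // x⁻¹ * g * x ∈
        (Subgroup.zpowers (sr 0 : DihedralGroup 8) ⊔ Subgroup.zpowers ((r 1 : DihedralGroup 8) ^ 4))} =
      if g = 1 ∨ g = r 4 then 16 else if ∃ k : ZMod 8, g = sr (2 * k) then 8 else 0 := by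
  classical
  rw [natCard_subtype_eq_card_filter_d8 _ _ fun x ↦ mem_kleinTau_eight_iff _]
  exact (marks_table_refl_eight g).2.2.1

/-- **Marks of `K' = ⟨στ, σ⁴⟩`**: `16` on `Z`, `8` on the odd reflections. [cite: BartelDokchitser2015, §1.1 Theorem A Case 1 ("ZH'")] -/
theorem card_conj_mem_kleinMul_dihedralEight (g : DihedralGroup 8) :
    Nat.card {x : DihedralGroup 8 // x⁻¹ * g * x ∈
        (Subgroup.zpowers ((r 1 : DihedralGroup 8) * sr 0) ⊔ Subgroup.zpowers ((r 1 : DihedralGroup 8) ^ 4))} =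
      if g = 1 ∨ g = r 4 then 16 else if ∃ k : ZMod 8, g = sr (2 * k + 1) then 8 else 0 := by
  classical
  rw [natCard_subtype_eq_card_filter_d8 _ _ fun x ↦ mem_kleinMul_eight_iff _]
  exact (marks_table_refl_eight g).2.2.2

/-- **Marks of `D = ⟨τ, σ²⟩ ⊴ D_8`**: `16·[g ∈ D]`. [cite: BartelDokchitser2015, §5 proof of Theorem 4] -/
theorem card_conj_mem_dihedralTau_dihedralEight (g : DihedralGroup 8) :
    Nat.card {x : DihedralGroup 8 // x⁻¹ * g * x ∈
        (Subgroup.zpowers (sr 0 : DihedralGroup 8) ⊔ Subgroup.zpowers ((r 1 : DihedralGroup 8) ^ 2))} =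
      if (∃ k : ZMod 8, g = r (2 * k)) ∨ ∃ k : ZMod 8, g = sr (2 * k) then 16 else 0 := by
  classical
  rw [natCard_subtype_eq_card_filter_d8 _ _ fun x ↦ mem_dihedralTau_eight_iff _]
  revert g
  decide

/-- **Marks of `D' = ⟨στ, σ²⟩ ⊴ D_8`**: `16·[g ∈ D']`. [cite: BartelDokchitser2015, §5 proof of Theorem 4] -/
theorem card_conj_mem_dihedralMul_dihedralEight (g : DihedralGroup 8) :
    Nat.card {x : DihedralGroup 8 // x⁻¹ * g * x ∈
        (Subgroup.zpowers ((r 1 : DihedralGroup 8) * sr 0) ⊔ Subgroup.zpowers ((r 1 : DihedralGroup 8) ^ 2))} =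
      if (∃ k : ZMod 8, g = r (2 * k)) ∨ ∃ k : ZMod 8, g = sr (2 * k + 1) then 16 else 0 := by
  classical
  rw [natCard_subtype_eq_card_filter_d8 _ _ fun x ↦ mem_dihedralMul_eight_iff _]
  revert g
  decide

/-- The orders `2, 4, 8, 2, 2, 4, 4, 8, 8` of `Z, ⟨σ²⟩, ⟨σ⟩, ⟨τ⟩, ⟨στ⟩, K, K', D, D'`. [cite: BartelDokchitser2015, §1.1 Theorem A Case 1 ("H ≅ C_2", "Z ≅ C_2", "ZH"); §5 proof of Theorem 4 ("D = C_2 × J … a proper subgroup of P")] -/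
theorem natCard_subgroups_dihedralEight :
    Nat.card (Subgroup.zpowers ((r 1 : DihedralGroup 8) ^ 4)) = 2 ∧ Nat.card (Subgroup.zpowers ((r 1 : DihedralGroup 8) ^ 2)) = 4 ∧
    Nat.card (Subgroup.zpowers (r 1 : DihedralGroup 8)) = 8 ∧ Nat.card (Subgroup.zpowers (sr 0 : DihedralGroup 8)) = 2 ∧
    Nat.card (Subgroup.zpowers ((r 1 : DihedralGroup 8) * sr 0)) = 2 ∧
    Nat.card ↥(Subgroup.zpowers (sr 0 : DihedralGroup 8) ⊔ Subgroup.zpowers ((r 1 : DihedralGroup 8) ^ 4)) = 4 ∧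
    Nat.card ↥(Subgroup.zpowers ((r 1 : DihedralGroup 8) * sr 0) ⊔ Subgroup.zpowers ((r 1 : DihedralGroup 8) ^ 4)) = 4 ∧
    Nat.card ↥(Subgroup.zpowers (sr 0 : DihedralGroup 8) ⊔ Subgroup.zpowers ((r 1 : DihedralGroup 8) ^ 2)) = 8 ∧
    Nat.card ↥(Subgroup.zpowers ((r 1 : DihedralGroup 8) * sr 0) ⊔ Subgroup.zpowers ((r 1 : DihedralGroup 8) ^ 2)) = 8 := by
  classical
  refine ⟨?_, ?_, ?_, ?_, ?_, ?_, ?_, ?_, ?_⟩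
  · rw [Nat.card_zpowers, dihedralGroup_eight_pow_mul.1, dihedralGroup_eight_orderOf_r_four]
  · rw [Nat.card_zpowers, dihedralGroup_eight_pow_mul.2.1, dihedralGroup_eight_orderOf_r_two]
  · rw [Nat.card_zpowers, orderOf_r_one]
  · rw [Nat.card_zpowers, orderOf_sr]
  · rw [Nat.card_zpowers, dihedralGroup_eight_pow_mul.2.2, orderOf_sr]
  · exact (natCard_subtype_eq_card_filter_d8 _ _ mem_kleinTau_eight_iff).trans (by decide)
  · exact (natCard_subtype_eq_card_filter_d8 _ _ mem_kleinMul_eight_iff).trans (by decide)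
  · exact (natCard_subtype_eq_card_filter_d8 _ _ mem_dihedralTau_eight_iff).trans (by decide)
  · exact (natCard_subtype_eq_card_filter_d8 _ _ mem_dihedralMul_eight_iff).trans (by decide)

/-- **The permutation characters of the eleven representatives, as explicit functions on `D_8`.**
[cite: BartelDokchitser2015, §1.1 ("Θ ∈ K(G) ⟺ Σ_i n_i Ind 1_{H_i} = 0")] -/
theorem indClassFun_one_apply_dihedralEight (g : DihedralGroup 8) :
    indClassFun (⊥ : Subgroup (DihedralGroup 8)) 1 g = (if g = 1 then 16 else 0) ∧
    indClassFun (Subgroup.zpowers ((r 1 : DihedralGroup 8) ^ 4)) 1 g = (if g = 1 ∨ g = r 4 then 8 else 0) ∧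
    indClassFun (Subgroup.zpowers ((r 1 : DihedralGroup 8) ^ 2)) 1 g = (if ∃ k : ZMod 8, g = r (2 * k) then 4 else 0) ∧
    indClassFun (Subgroup.zpowers (r 1 : DihedralGroup 8)) 1 g = (if ∃ k : ZMod 8, g = r k then 2 else 0) ∧
    indClassFun (Subgroup.zpowers (sr 0 : DihedralGroup 8)) 1 g =
      (if g = 1 then 8 else if ∃ k : ZMod 8, g = sr (2 * k) then 2 else 0) ∧
    indClassFun (Subgroup.zpowers ((r 1 : DihedralGroup 8) * sr 0)) 1 g =
      (if g = 1 then 8 else if ∃ k : ZMod 8, g = sr (2 * k + 1) then 2 else 0) ∧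
    indClassFun (Subgroup.zpowers (sr 0 : DihedralGroup 8) ⊔ Subgroup.zpowers ((r 1 : DihedralGroup 8) ^ 4)) 1 g =
      (if g = 1 ∨ g = r 4 then 4 else if ∃ k : ZMod 8, g = sr (2 * k) then 2 else 0) ∧
    indClassFun (Subgroup.zpowers ((r 1 : DihedralGroup 8) * sr 0) ⊔ Subgroup.zpowers ((r 1 : DihedralGroup 8) ^ 4)) 1 g =
      (if g = 1 ∨ g = r 4 then 4 else if ∃ k : ZMod 8, g = sr (2 * k + 1) then 2 else 0) ∧
    indClassFun (Subgroup.zpowers (sr 0 : DihedralGroup 8) ⊔ Subgroup.zpowers ((r 1 : DihedralGroup 8) ^ 2)) 1 g =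
      (if (∃ k : ZMod 8, g = r (2 * k)) ∨ ∃ k : ZMod 8, g = sr (2 * k) then 2 else 0) ∧
    indClassFun (Subgroup.zpowers ((r 1 : DihedralGroup 8) * sr 0) ⊔ Subgroup.zpowers ((r 1 : DihedralGroup 8) ^ 2)) 1 g =
      (if (∃ k : ZMod 8, g = r (2 * k)) ∨ ∃ k : ZMod 8, g = sr (2 * k + 1) then 2 else 0) ∧
    indClassFun (⊤ : Subgroup (DihedralGroup 8)) 1 g = 1 := by
  classical
  obtain ⟨c1, c2, c3, c4, c5, c6, c7, c8, c9⟩ := natCard_subgroups_dihedralEight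
  refine ⟨?_, ?_, ?_, ?_, ?_, ?_, ?_, ?_, ?_, ?_, ?_⟩
  · rw [indClassFun_one_apply_eq_div, card_conj_mem_bot, Subgroup.card_bot, card_dihedralGroup_eight]
    split_ifs <;> norm_num
  · rw [indClassFun_one_apply_eq_div, card_conj_mem_center_dihedralEight, c1]
    split_ifs <;> norm_num
  · rw [indClassFun_one_apply_eq_div, card_conj_mem_zpowers_sq_dihedralEight, c2]
    split_ifs <;> norm_num
  · rw [indClassFun_one_apply_eq_div, card_conj_mem_zpowers_r_one_dihedralEight, c3]
    split_ifs <;> norm_num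
  · rw [indClassFun_one_apply_eq_div, card_conj_mem_zpowers_sr_zero_dihedralEight, c4]
    split_ifs <;> norm_num
  · rw [indClassFun_one_apply_eq_div, card_conj_mem_zpowers_mul_dihedralEight, c5]
    split_ifs <;> norm_num
  · rw [indClassFun_one_apply_eq_div, card_conj_mem_kleinTau_dihedralEight, c6]
    split_ifs <;> norm_num
  · rw [indClassFun_one_apply_eq_div, card_conj_mem_kleinMul_dihedralEight, c7]
    split_ifs <;> norm_num
  · rw [indClassFun_one_apply_eq_div, card_conj_mem_dihedralTau_dihedralEight, c8]
    split_ifs <;> norm_num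
  · rw [indClassFun_one_apply_eq_div, card_conj_mem_dihedralMul_dihedralEight, c9]
    split_ifs <;> norm_num
  · rw [indClassFun_top_one, Pi.one_apply]

end DihedralEightCharacters

/-! ## §3 The six class equations; the seven named relations -/

section DihedralEightRelations

/-- An eleven-term sum of scalar multiples of functions, evaluated at a point. [folklore] -/
private theorem sum_fin_eleven_smul_apply (a : Fin 11 → ℤ) (F : Fin 11 → DihedralGroup 8 → ℂ) (g : DihedralGroup 8) :
    (∑ i : Fin 11, (a i : ℂ) • F i) g = a 0 * F 0 g + a 1 * F 1 g + a 2 * F 2 g + a 3 * F 3 g + a 4 * F 4 g +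
      a 5 * F 5 g + a 6 * F 6 g + a 7 * F 7 g + a 8 * F 8 g + a 9 * F 9 g + a 10 * F 10 g := by
  simp [Finset.sum_apply, Fin.sum_univ_succ]
  ring

/-- The signed-sum test on the eleven representatives `![1, Z, ⟨σ²⟩, ⟨σ⟩, ⟨τ⟩, ⟨στ⟩, K, K', D, D', G]`, pointwise.
[cite: BartelDokchitser2015, §1.1 ("Θ ∈ K(G) ⟺ Σ_i n_i Ind 1_{H_i} = 0")] -/
theorem sum_smul_indClassFun_dihedralEight_apply (a : Fin 11 → ℤ) (g : DihedralGroup 8) :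
    (∑ i : Fin 11, (a i : ℂ) • indClassFun ((![⊥, Subgroup.zpowers ((r 1 : DihedralGroup 8) ^ 4),
        Subgroup.zpowers ((r 1 : DihedralGroup 8) ^ 2), Subgroup.zpowers (r 1 : DihedralGroup 8),
        Subgroup.zpowers (sr 0 : DihedralGroup 8), Subgroup.zpowers ((r 1 : DihedralGroup 8) * sr 0),
        Subgroup.zpowers (sr 0 : DihedralGroup 8) ⊔ Subgroup.zpowers ((r 1 : DihedralGroup 8) ^ 4),
        Subgroup.zpowers ((r 1 : DihedralGroup 8) * sr 0) ⊔ Subgroup.zpowers ((r 1 : DihedralGroup 8) ^ 4),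
        Subgroup.zpowers (sr 0 : DihedralGroup 8) ⊔ Subgroup.zpowers ((r 1 : DihedralGroup 8) ^ 2),
        Subgroup.zpowers ((r 1 : DihedralGroup 8) * sr 0) ⊔ Subgroup.zpowers ((r 1 : DihedralGroup 8) ^ 2), ⊤] :
        Fin 11 → Subgroup (DihedralGroup 8)) i) 1) g =
      a 0 * (if g = 1 then 16 else 0) + a 1 * (if g = 1 ∨ g = r 4 then 8 else 0) +
        a 2 * (if ∃ k : ZMod 8, g = r (2 * k) then 4 else 0) + a 3 * (if ∃ k : ZMod 8, g = r k then 2 else 0) +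
        a 4 * (if g = 1 then 8 else if ∃ k : ZMod 8, g = sr (2 * k) then 2 else 0) +
        a 5 * (if g = 1 then 8 else if ∃ k : ZMod 8, g = sr (2 * k + 1) then 2 else 0) +
        a 6 * (if g = 1 ∨ g = r 4 then 4 else if ∃ k : ZMod 8, g = sr (2 * k) then 2 else 0) +
        a 7 * (if g = 1 ∨ g = r 4 then 4 else if ∃ k : ZMod 8, g = sr (2 * k + 1) then 2 else 0) +
        a 8 * (if (∃ k : ZMod 8, g = r (2 * k)) ∨ ∃ k : ZMod 8, g = sr (2 * k) then 2 else 0) +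
        a 9 * (if (∃ k : ZMod 8, g = r (2 * k)) ∨ ∃ k : ZMod 8, g = sr (2 * k + 1) then 2 else 0) + a 10 := by
  obtain ⟨h0, h1, h2, h3, h4, h5, h6, h7, h8, h9, h10⟩ := indClassFun_one_apply_dihedralEight g
  rw [sum_fin_eleven_smul_apply]
  show (a 0 : ℂ) * indClassFun (⊥ : Subgroup (DihedralGroup 8)) 1 g +
      (a 1 : ℂ) * indClassFun (Subgroup.zpowers ((r 1 : DihedralGroup 8) ^ 4)) 1 g +
      (a 2 : ℂ) * indClassFun (Subgroup.zpowers ((r 1 : DihedralGroup 8) ^ 2)) 1 g +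
      (a 3 : ℂ) * indClassFun (Subgroup.zpowers (r 1 : DihedralGroup 8)) 1 g +
      (a 4 : ℂ) * indClassFun (Subgroup.zpowers (sr 0 : DihedralGroup 8)) 1 g +
      (a 5 : ℂ) * indClassFun (Subgroup.zpowers ((r 1 : DihedralGroup 8) * sr 0)) 1 g +
      (a 6 : ℂ) * indClassFun (Subgroup.zpowers (sr 0 : DihedralGroup 8) ⊔ Subgroup.zpowers ((r 1 : DihedralGroup 8) ^ 4)) 1 g +
      (a 7 : ℂ) * indClassFun (Subgroup.zpowers ((r 1 : DihedralGroup 8) * sr 0) ⊔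
        Subgroup.zpowers ((r 1 : DihedralGroup 8) ^ 4)) 1 g +
      (a 8 : ℂ) * indClassFun (Subgroup.zpowers (sr 0 : DihedralGroup 8) ⊔ Subgroup.zpowers ((r 1 : DihedralGroup 8) ^ 2)) 1 g +
      (a 9 : ℂ) * indClassFun (Subgroup.zpowers ((r 1 : DihedralGroup 8) * sr 0) ⊔
        Subgroup.zpowers ((r 1 : DihedralGroup 8) ^ 2)) 1 g +
      (a 10 : ℂ) * indClassFun (⊤ : Subgroup (DihedralGroup 8)) 1 g = _
  rw [h0, h1, h2, h3, h4, h5, h6, h7, h8, h9, h10, mul_one]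

/-- **The Brauer relations of `D_8` are exactly the integer vectors `a` on
`![1, Z, ⟨σ²⟩, ⟨σ⟩, ⟨τ⟩, ⟨στ⟩, K, K', D, D', G]` with `a_1 = −a_Z − a_{σ²} − a_σ`, `a_τ = a_σ − a_K − a_D`,
`a_{στ} = a_σ + 2a_Z + 2a_{σ²} + a_K + a_D`, `a_{K'} = −2a_Z − a_K`, `a_{D'} = −2a_{σ²} − a_D`, `a_G = −2a_σ`** (free
parameters `a_Z, a_{σ²}, a_σ, a_K, a_D`: rank `5` = the classes of non-cyclic subgroups `K, K', D, D', G`) — the six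
class equations at `1, σ⁴, σ², σ, τ, στ` solved. [cite: BartelDokchitser2015, §1.1; §2 ("the rank of K(G) is the number of conjugacy classes of non-cyclic subgroups")] -/
theorem sum_smul_indClassFun_dihedralEight_eq_zero_iff (a : Fin 11 → ℤ) :
    ∑ i : Fin 11, (a i : ℂ) • indClassFun ((![⊥, Subgroup.zpowers ((r 1 : DihedralGroup 8) ^ 4),
        Subgroup.zpowers ((r 1 : DihedralGroup 8) ^ 2), Subgroup.zpowers (r 1 : DihedralGroup 8),
        Subgroup.zpowers (sr 0 : DihedralGroup 8), Subgroup.zpowers ((r 1 : DihedralGroup 8) * sr 0),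
        Subgroup.zpowers (sr 0 : DihedralGroup 8) ⊔ Subgroup.zpowers ((r 1 : DihedralGroup 8) ^ 4),
        Subgroup.zpowers ((r 1 : DihedralGroup 8) * sr 0) ⊔ Subgroup.zpowers ((r 1 : DihedralGroup 8) ^ 4),
        Subgroup.zpowers (sr 0 : DihedralGroup 8) ⊔ Subgroup.zpowers ((r 1 : DihedralGroup 8) ^ 2),
        Subgroup.zpowers ((r 1 : DihedralGroup 8) * sr 0) ⊔ Subgroup.zpowers ((r 1 : DihedralGroup 8) ^ 2), ⊤] :
        Fin 11 → Subgroup (DihedralGroup 8)) i) 1 = 0 ↔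
      a 0 = -a 1 - a 2 - a 3 ∧ a 4 = a 3 - a 6 - a 8 ∧ a 5 = a 3 + 2 * a 1 + 2 * a 2 + a 6 + a 8 ∧
        a 7 = -2 * a 1 - a 6 ∧ a 9 = -2 * a 2 - a 8 ∧ a 10 = -2 * a 3 := by
  constructor
  · intro h
    have e := fun g ↦ (sum_smul_indClassFun_dihedralEight_apply a g).symm.trans (congr_fun h g)
    have e1 := e 1
    have e2 := e (r 4)
    have e3 := e (r 2)
    have e4 := e (r 1)
    have e5 := e (sr 0)
    have e6 := e (sr 1)
    simp (config := { decide := true }) only [Pi.zero_apply, if_true, if_false, mul_zero, add_zero] at e1 e2 e3 e4 e5 e6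
    have i1 : ((16 * a 0 + 8 * a 1 + 4 * a 2 + 2 * a 3 + 8 * a 4 + 8 * a 5 + 4 * a 6 + 4 * a 7 + 2 * a 8 + 2 * a 9 +
        a 10 : ℤ) : ℂ) = 0 := by
      push_cast; linear_combination e1
    have i2 : ((8 * a 1 + 4 * a 2 + 2 * a 3 + 4 * a 6 + 4 * a 7 + 2 * a 8 + 2 * a 9 + a 10 : ℤ) : ℂ) = 0 := by
      push_cast; linear_combination e2
    have i3 : ((4 * a 2 + 2 * a 3 + 2 * a 8 + 2 * a 9 + a 10 : ℤ) : ℂ) = 0 := by push_cast; linear_combination e3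
    have i4 : ((2 * a 3 + a 10 : ℤ) : ℂ) = 0 := by push_cast; linear_combination e4
    have i5 : ((2 * a 4 + 2 * a 6 + 2 * a 8 + a 10 : ℤ) : ℂ) = 0 := by push_cast; linear_combination e5
    have i6 : ((2 * a 5 + 2 * a 7 + 2 * a 9 + a 10 : ℤ) : ℂ) = 0 := by push_cast; linear_combination e6
    norm_cast at i1 i2 i3 i4 i5 i6
    omega
  · rintro ⟨h0, h4, h5, h7, h9, h10⟩
    funext g
    rw [sum_smul_indClassFun_dihedralEight_apply, Pi.zero_apply, h0, h4, h5, h7, h9, h10]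
    push_cast
    rcases dihedralGroup_eight_cases g with rfl | rfl | (rfl | rfl) | (rfl | rfl | rfl | rfl) |
        (rfl | rfl | rfl | rfl) | (rfl | rfl | rfl | rfl) <;>
    · simp (config := { decide := true }) only [if_true, if_false]
      ring

/-- **`Θ_dih = ⟨τ⟩ − ⟨στ⟩ − K + K'`, Theorem A's `H − H' − ZH + ZH'` for `D_8`, is a relation** (g28-#1 with `m = 2`).
[cite: BartelDokchitser2015, §1.1 Theorem A Case 1; §5 Theorem 4 (3)] -/
theorem thetaDih_mem_dihedralEight :
    ∑ i : Fin 11, (((![0, 0, 0, 0, 1, -1, -1, 1, 0, 0, 0] : Fin 11 → ℤ) i : ℤ) : ℂ) • indClassFun ((![⊥, Subgroup.zpowers ((r 1 : DihedralGroup 8) ^ 4),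
        Subgroup.zpowers ((r 1 : DihedralGroup 8) ^ 2), Subgroup.zpowers (r 1 : DihedralGroup 8),
        Subgroup.zpowers (sr 0 : DihedralGroup 8), Subgroup.zpowers ((r 1 : DihedralGroup 8) * sr 0),
        Subgroup.zpowers (sr 0 : DihedralGroup 8) ⊔ Subgroup.zpowers ((r 1 : DihedralGroup 8) ^ 4),
        Subgroup.zpowers ((r 1 : DihedralGroup 8) * sr 0) ⊔ Subgroup.zpowers ((r 1 : DihedralGroup 8) ^ 4),
        Subgroup.zpowers (sr 0 : DihedralGroup 8) ⊔ Subgroup.zpowers ((r 1 : DihedralGroup 8) ^ 2),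
        Subgroup.zpowers ((r 1 : DihedralGroup 8) * sr 0) ⊔ Subgroup.zpowers ((r 1 : DihedralGroup 8) ^ 2), ⊤] :
        Fin 11 → Subgroup (DihedralGroup 8)) i) 1 = 0 :=
  (sum_smul_indClassFun_dihedralEight_eq_zero_iff _).2 (by simp)

/-- **`Inf Θ_dih(D_4) = K − K' − D + D'`, the LIFT from `D_8/Z ≅ D_4` of `D_4`'s dihedral relation**
(`⟨τ̄⟩ ↦ K`, `⟨ρτ̄⟩ ↦ K'`, `K_τ̄ ↦ D`, `K_{ρτ̄} ↦ D'`), is a relation. [cite: BartelDokchitser2015, §2 (Inflation); §5 Theorem 4 (3)] -/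
theorem infDih_mem_dihedralEight :
    ∑ i : Fin 11, (((![0, 0, 0, 0, 0, 0, 1, -1, -1, 1, 0] : Fin 11 → ℤ) i : ℤ) : ℂ) • indClassFun ((![⊥, Subgroup.zpowers ((r 1 : DihedralGroup 8) ^ 4),
        Subgroup.zpowers ((r 1 : DihedralGroup 8) ^ 2), Subgroup.zpowers (r 1 : DihedralGroup 8),
        Subgroup.zpowers (sr 0 : DihedralGroup 8), Subgroup.zpowers ((r 1 : DihedralGroup 8) * sr 0),
        Subgroup.zpowers (sr 0 : DihedralGroup 8) ⊔ Subgroup.zpowers ((r 1 : DihedralGroup 8) ^ 4),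
        Subgroup.zpowers ((r 1 : DihedralGroup 8) * sr 0) ⊔ Subgroup.zpowers ((r 1 : DihedralGroup 8) ^ 4),
        Subgroup.zpowers (sr 0 : DihedralGroup 8) ⊔ Subgroup.zpowers ((r 1 : DihedralGroup 8) ^ 2),
        Subgroup.zpowers ((r 1 : DihedralGroup 8) * sr 0) ⊔ Subgroup.zpowers ((r 1 : DihedralGroup 8) ^ 2), ⊤] :
        Fin 11 → Subgroup (DihedralGroup 8)) i) 1 = 0 :=
  (sum_smul_indClassFun_dihedralEight_eq_zero_iff _).2 (by simp)

/-- **`⟨σ²⟩ − ⟨σ⟩ − D − D' + 2G`, the LIFT from `D_8/⟨σ²⟩ ≅ C_2 × C_2` of `1 − Σ_C C + 2·(C_2 × C_2)`** (equivalently the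
lift of `D_4`'s `Θ_inf`), is a relation. [cite: BartelDokchitser2015, §2 (Inflation; Example 3); §5 Theorem 4 (1)] -/
theorem infKlein_mem_dihedralEight :
    ∑ i : Fin 11, (((![0, 0, 1, -1, 0, 0, 0, 0, -1, -1, 2] : Fin 11 → ℤ) i : ℤ) : ℂ) • indClassFun ((![⊥, Subgroup.zpowers ((r 1 : DihedralGroup 8) ^ 4),
        Subgroup.zpowers ((r 1 : DihedralGroup 8) ^ 2), Subgroup.zpowers (r 1 : DihedralGroup 8),
        Subgroup.zpowers (sr 0 : DihedralGroup 8), Subgroup.zpowers ((r 1 : DihedralGroup 8) * sr 0),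
        Subgroup.zpowers (sr 0 : DihedralGroup 8) ⊔ Subgroup.zpowers ((r 1 : DihedralGroup 8) ^ 4),
        Subgroup.zpowers ((r 1 : DihedralGroup 8) * sr 0) ⊔ Subgroup.zpowers ((r 1 : DihedralGroup 8) ^ 4),
        Subgroup.zpowers (sr 0 : DihedralGroup 8) ⊔ Subgroup.zpowers ((r 1 : DihedralGroup 8) ^ 2),
        Subgroup.zpowers ((r 1 : DihedralGroup 8) * sr 0) ⊔ Subgroup.zpowers ((r 1 : DihedralGroup 8) ^ 2), ⊤] :
        Fin 11 → Subgroup (DihedralGroup 8)) i) 1 = 0 :=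
  (sum_smul_indClassFun_dihedralEight_eq_zero_iff _).2 (by simp)

/-- **`Z − ⟨σ²⟩ − 2K + 2D`, the lift from `D_8/Z ≅ D_4` of `D_4`'s induced relation `Θ_ind`** (equivalently: induced
from `D ≅ D_4`, its own lifted `C_2 × C_2` relation, with `⟨σ²τ, σ⁴⟩` conjugate in `D_8` to `K`), is a relation.
[cite: BartelDokchitser2015, §2 (Inflation, Induction); §3 Remark 2; §5 Theorem 4 (1)] -/
theorem infInd_mem_dihedralEight :
    ∑ i : Fin 11, (((![0, 1, -1, 0, 0, 0, -2, 0, 2, 0, 0] : Fin 11 → ℤ) i : ℤ) : ℂ) • indClassFun ((![⊥, Subgroup.zpowers ((r 1 : DihedralGroup 8) ^ 4),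
        Subgroup.zpowers ((r 1 : DihedralGroup 8) ^ 2), Subgroup.zpowers (r 1 : DihedralGroup 8),
        Subgroup.zpowers (sr 0 : DihedralGroup 8), Subgroup.zpowers ((r 1 : DihedralGroup 8) * sr 0),
        Subgroup.zpowers (sr 0 : DihedralGroup 8) ⊔ Subgroup.zpowers ((r 1 : DihedralGroup 8) ^ 4),
        Subgroup.zpowers ((r 1 : DihedralGroup 8) * sr 0) ⊔ Subgroup.zpowers ((r 1 : DihedralGroup 8) ^ 4),
        Subgroup.zpowers (sr 0 : DihedralGroup 8) ⊔ Subgroup.zpowers ((r 1 : DihedralGroup 8) ^ 2),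
        Subgroup.zpowers ((r 1 : DihedralGroup 8) * sr 0) ⊔ Subgroup.zpowers ((r 1 : DihedralGroup 8) ^ 2), ⊤] :
        Fin 11 → Subgroup (DihedralGroup 8)) i) 1 = 0 :=
  (sum_smul_indClassFun_dihedralEight_eq_zero_iff _).2 (by simp)

/-- **`Z − ⟨σ²⟩ − 2K' + 2D'`**, the same through `D'`, is a relation. [cite: BartelDokchitser2015, §2; §5 Theorem 4 (1)] -/
theorem infInd'_mem_dihedralEight :
    ∑ i : Fin 11, (((![0, 1, -1, 0, 0, 0, 0, -2, 0, 2, 0] : Fin 11 → ℤ) i : ℤ) : ℂ) • indClassFun ((![⊥, Subgroup.zpowers ((r 1 : DihedralGroup 8) ^ 4),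
        Subgroup.zpowers ((r 1 : DihedralGroup 8) ^ 2), Subgroup.zpowers (r 1 : DihedralGroup 8),
        Subgroup.zpowers (sr 0 : DihedralGroup 8), Subgroup.zpowers ((r 1 : DihedralGroup 8) * sr 0),
        Subgroup.zpowers (sr 0 : DihedralGroup 8) ⊔ Subgroup.zpowers ((r 1 : DihedralGroup 8) ^ 4),
        Subgroup.zpowers ((r 1 : DihedralGroup 8) * sr 0) ⊔ Subgroup.zpowers ((r 1 : DihedralGroup 8) ^ 4),
        Subgroup.zpowers (sr 0 : DihedralGroup 8) ⊔ Subgroup.zpowers ((r 1 : DihedralGroup 8) ^ 2),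
        Subgroup.zpowers ((r 1 : DihedralGroup 8) * sr 0) ⊔ Subgroup.zpowers ((r 1 : DihedralGroup 8) ^ 2), ⊤] :
        Fin 11 → Subgroup (DihedralGroup 8)) i) 1 = 0 :=
  (sum_smul_indClassFun_dihedralEight_eq_zero_iff _).2 (by simp)

/-- **`1 − Z − 2⟨τ⟩ + 2K`, INDUCED from the Klein four-group `K`** (`1 − Z − ⟨τ⟩ − ⟨σ⁴τ⟩ + 2K` with `⟨σ⁴τ⟩`
conjugate in `D_8` to `⟨τ⟩` — "they might represent the “wrong” conjugacy classes"), is a relation.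
[cite: BartelDokchitser2015, §2 (Induction; Example 3); §3 Remark 2; §5 Theorem 4 (1)] -/
theorem indKlein_mem_dihedralEight :
    ∑ i : Fin 11, (((![1, -1, 0, 0, -2, 0, 2, 0, 0, 0, 0] : Fin 11 → ℤ) i : ℤ) : ℂ) • indClassFun ((![⊥, Subgroup.zpowers ((r 1 : DihedralGroup 8) ^ 4),
        Subgroup.zpowers ((r 1 : DihedralGroup 8) ^ 2), Subgroup.zpowers (r 1 : DihedralGroup 8),
        Subgroup.zpowers (sr 0 : DihedralGroup 8), Subgroup.zpowers ((r 1 : DihedralGroup 8) * sr 0),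
        Subgroup.zpowers (sr 0 : DihedralGroup 8) ⊔ Subgroup.zpowers ((r 1 : DihedralGroup 8) ^ 4),
        Subgroup.zpowers ((r 1 : DihedralGroup 8) * sr 0) ⊔ Subgroup.zpowers ((r 1 : DihedralGroup 8) ^ 4),
        Subgroup.zpowers (sr 0 : DihedralGroup 8) ⊔ Subgroup.zpowers ((r 1 : DihedralGroup 8) ^ 2),
        Subgroup.zpowers ((r 1 : DihedralGroup 8) * sr 0) ⊔ Subgroup.zpowers ((r 1 : DihedralGroup 8) ^ 2), ⊤] :
        Fin 11 → Subgroup (DihedralGroup 8)) i) 1 = 0 :=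
  (sum_smul_indClassFun_dihedralEight_eq_zero_iff _).2 (by simp)

/-- **`1 − Z − 2⟨στ⟩ + 2K'`, induced from `K'`**, is a relation. [cite: BartelDokchitser2015, §2 (Induction); §5 Theorem 4 (1)] -/
theorem indKlein'_mem_dihedralEight :
    ∑ i : Fin 11, (((![1, -1, 0, 0, 0, -2, 0, 2, 0, 0, 0] : Fin 11 → ℤ) i : ℤ) : ℂ) • indClassFun ((![⊥, Subgroup.zpowers ((r 1 : DihedralGroup 8) ^ 4),
        Subgroup.zpowers ((r 1 : DihedralGroup 8) ^ 2), Subgroup.zpowers (r 1 : DihedralGroup 8),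
        Subgroup.zpowers (sr 0 : DihedralGroup 8), Subgroup.zpowers ((r 1 : DihedralGroup 8) * sr 0),
        Subgroup.zpowers (sr 0 : DihedralGroup 8) ⊔ Subgroup.zpowers ((r 1 : DihedralGroup 8) ^ 4),
        Subgroup.zpowers ((r 1 : DihedralGroup 8) * sr 0) ⊔ Subgroup.zpowers ((r 1 : DihedralGroup 8) ^ 4),
        Subgroup.zpowers (sr 0 : DihedralGroup 8) ⊔ Subgroup.zpowers ((r 1 : DihedralGroup 8) ^ 2),
        Subgroup.zpowers ((r 1 : DihedralGroup 8) * sr 0) ⊔ Subgroup.zpowers ((r 1 : DihedralGroup 8) ^ 2), ⊤] :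
        Fin 11 → Subgroup (DihedralGroup 8)) i) 1 = 0 :=
  (sum_smul_indClassFun_dihedralEight_eq_zero_iff _).2 (by simp)

/-- **`2Θ_dih = Ind_{K'} − Ind_K`**: twice the dihedral relation is a difference of two INDUCED relations — the source
of "`Prim(D_{16}) = ℤ/2ℤ`". [cite: BartelDokchitser2015, §1.1 Theorem A Case 1 ("Prim(G) = ℤ/2ℤ")] -/
theorem two_smul_thetaDih_eq_dihedralEight :
    (2 : ℤ) • (![0, 0, 0, 0, 1, -1, -1, 1, 0, 0, 0] : Fin 11 → ℤ) = ![1, -1, 0, 0, 0, -2, 0, 2, 0, 0, 0] - ![1, -1, 0, 0, -2, 0, 2, 0, 0, 0, 0] := by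
  decide

end DihedralEightRelations

/-! ## §4 `K(D_8)`: rank `5`, a basis, and `Prim(D_{16}) = K(D_8)/Imprim ≅ ℤ/2ℤ` generated by `Θ_dih` -/

section DihedralEightLattice

variable (𝒦 : Submodule ℤ (Fin 11 → ℤ))
  (h𝒦 : ∀ a : Fin 11 → ℤ, a ∈ 𝒦 ↔ ∑ i : Fin 11, (a i : ℂ) • indClassFun ((![⊥, Subgroup.zpowers ((r 1 : DihedralGroup 8) ^ 4),
        Subgroup.zpowers ((r 1 : DihedralGroup 8) ^ 2), Subgroup.zpowers (r 1 : DihedralGroup 8),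
        Subgroup.zpowers (sr 0 : DihedralGroup 8), Subgroup.zpowers ((r 1 : DihedralGroup 8) * sr 0),
        Subgroup.zpowers (sr 0 : DihedralGroup 8) ⊔ Subgroup.zpowers ((r 1 : DihedralGroup 8) ^ 4),
        Subgroup.zpowers ((r 1 : DihedralGroup 8) * sr 0) ⊔ Subgroup.zpowers ((r 1 : DihedralGroup 8) ^ 4),
        Subgroup.zpowers (sr 0 : DihedralGroup 8) ⊔ Subgroup.zpowers ((r 1 : DihedralGroup 8) ^ 2),
        Subgroup.zpowers ((r 1 : DihedralGroup 8) * sr 0) ⊔ Subgroup.zpowers ((r 1 : DihedralGroup 8) ^ 2), ⊤] :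
        Fin 11 → Subgroup (DihedralGroup 8)) i) 1 = 0)
include h𝒦

/-- **Membership in `K(D_8)` in coordinates.** [cite: BartelDokchitser2015, §1.1; §2] -/
theorem mem_brauerRelations_dihedralEight_iff (a : Fin 11 → ℤ) :
    a ∈ 𝒦 ↔ a 0 = -a 1 - a 2 - a 3 ∧ a 4 = a 3 - a 6 - a 8 ∧ a 5 = a 3 + 2 * a 1 + 2 * a 2 + a 6 + a 8 ∧
        a 7 = -2 * a 1 - a 6 ∧ a 9 = -2 * a 2 - a 8 ∧ a 10 = -2 * a 3 :=
  (h𝒦 a).trans (sum_smul_indClassFun_dihedralEight_eq_zero_iff a)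

/-- `Θ_dih ∈ K(D_8)`. [cite: BartelDokchitser2015, §1.1 Theorem A Case 1] -/
theorem thetaDih_mem_brauerRelations_dihedralEight : (![0, 0, 0, 0, 1, -1, -1, 1, 0, 0, 0] : Fin 11 → ℤ) ∈ 𝒦 :=
  (h𝒦 _).2 thetaDih_mem_dihedralEight

/-- `Inf Θ_dih(D_4) ∈ K(D_8)`. [cite: BartelDokchitser2015, §2 (Inflation)] -/
theorem infDih_mem_brauerRelations_dihedralEight : (![0, 0, 0, 0, 0, 0, 1, -1, -1, 1, 0] : Fin 11 → ℤ) ∈ 𝒦 :=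
  (h𝒦 _).2 infDih_mem_dihedralEight

/-- The `C_2 × C_2` lift `∈ K(D_8)`. [cite: BartelDokchitser2015, §2 (Inflation); §5 Theorem 4 (1)] -/
theorem infKlein_mem_brauerRelations_dihedralEight : (![0, 0, 1, -1, 0, 0, 0, 0, -1, -1, 2] : Fin 11 → ℤ) ∈ 𝒦 :=
  (h𝒦 _).2 infKlein_mem_dihedralEight

/-- `Z − ⟨σ²⟩ − 2K + 2D ∈ K(D_8)`. [cite: BartelDokchitser2015, §2; §5 Theorem 4 (1)] -/
theorem infInd_mem_brauerRelations_dihedralEight : (![0, 1, -1, 0, 0, 0, -2, 0, 2, 0, 0] : Fin 11 → ℤ) ∈ 𝒦 :=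
  (h𝒦 _).2 infInd_mem_dihedralEight

/-- `Z − ⟨σ²⟩ − 2K' + 2D' ∈ K(D_8)`. [cite: BartelDokchitser2015, §2; §5 Theorem 4 (1)] -/
theorem infInd'_mem_brauerRelations_dihedralEight : (![0, 1, -1, 0, 0, 0, 0, -2, 0, 2, 0] : Fin 11 → ℤ) ∈ 𝒦 :=
  (h𝒦 _).2 infInd'_mem_dihedralEight

/-- `Ind_K ∈ K(D_8)`. [cite: BartelDokchitser2015, §2 (Induction)] -/
theorem indKlein_mem_brauerRelations_dihedralEight : (![1, -1, 0, 0, -2, 0, 2, 0, 0, 0, 0] : Fin 11 → ℤ) ∈ 𝒦 :=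
  (h𝒦 _).2 indKlein_mem_dihedralEight

/-- `Ind_{K'} ∈ K(D_8)`. [cite: BartelDokchitser2015, §2 (Induction)] -/
theorem indKlein'_mem_brauerRelations_dihedralEight : (![1, -1, 0, 0, 0, -2, 0, 2, 0, 0, 0] : Fin 11 → ℤ) ∈ 𝒦 :=
  (h𝒦 _).2 indKlein'_mem_dihedralEight

/-- **Every relation of `D_8` is an explicit combination of `Θ_dih`, `Inf Θ_dih(D_4)`, the `C_2 × C_2` lift,
`Z − ⟨σ²⟩ − 2K' + 2D'` and `Ind_{K'}`** (Theorem 4 for `D_8`, made explicit). [cite: BartelDokchitser2015, §5 Theorem 4; §1.1 Theorem A Case 1] -/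
theorem eq_combination_of_mem_brauerRelations_dihedralEight {a : Fin 11 → ℤ} (ha : a ∈ 𝒦) :
    a = (a 3 - a 6 - a 8) • (![0, 0, 0, 0, 1, -1, -1, 1, 0, 0, 0] : Fin 11 → ℤ) + (a 3 - a 8) • (![0, 0, 0, 0, 0, 0, 1, -1, -1, 1, 0] : Fin 11 → ℤ) +
      (-a 3) • (![0, 0, 1, -1, 0, 0, 0, 0, -1, -1, 2] : Fin 11 → ℤ) + (-a 2 - a 3) • (![0, 1, -1, 0, 0, 0, 0, -2, 0, 2, 0] : Fin 11 → ℤ) +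
      (-a 1 - a 2 - a 3) • (![1, -1, 0, 0, 0, -2, 0, 2, 0, 0, 0] : Fin 11 → ℤ) := by
  obtain ⟨h0, h4, h5, h7, h9, h10⟩ := (mem_brauerRelations_dihedralEight_iff 𝒦 h𝒦 a).1 ha
  funext i
  fin_cases i <;> simp <;> omega

/-- **`K(D_8) = ℤΘ_dih + ℤ·Inf Θ_dih(D_4) + ℤ·(C_2×C_2 lift) + ℤ·(Z − ⟨σ²⟩ − 2K' + 2D') + ℤ·Ind_{K'}`.**
[cite: BartelDokchitser2015, §5 Theorem 4; §1.1 Theorem A Case 1] -/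
theorem brauerRelations_dihedralEight_eq_span :
    𝒦 = Submodule.span ℤ {(![0, 0, 0, 0, 1, -1, -1, 1, 0, 0, 0] : Fin 11 → ℤ), ![0, 0, 0, 0, 0, 0, 1, -1, -1, 1, 0], ![0, 0, 1, -1, 0, 0, 0, 0, -1, -1, 2], ![0, 1, -1, 0, 0, 0, 0, -2, 0, 2, 0], ![1, -1, 0, 0, 0, -2, 0, 2, 0, 0, 0]} := by
  refine le_antisymm (fun a ha ↦ ?_) (Submodule.span_le.2 ?_)
  · rw [eq_combination_of_mem_brauerRelations_dihedralEight 𝒦 h𝒦 ha]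
    refine Submodule.add_mem _ (Submodule.add_mem _ (Submodule.add_mem _ (Submodule.add_mem _
      (Submodule.smul_mem _ _ (Submodule.subset_span (by simp)))
      (Submodule.smul_mem _ _ (Submodule.subset_span (by simp))))
      (Submodule.smul_mem _ _ (Submodule.subset_span (by simp))))
      (Submodule.smul_mem _ _ (Submodule.subset_span (by simp))))
      (Submodule.smul_mem _ _ (Submodule.subset_span (by simp)))
  · rintro v (rfl | rfl | rfl | rfl | rfl)
    · exact thetaDih_mem_brauerRelations_dihedralEight 𝒦 h𝒦
    · exact infDih_mem_brauerRelations_dihedralEight 𝒦 h𝒦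
    · exact infKlein_mem_brauerRelations_dihedralEight 𝒦 h𝒦
    · exact infInd'_mem_brauerRelations_dihedralEight 𝒦 h𝒦
    · exact indKlein'_mem_brauerRelations_dihedralEight 𝒦 h𝒦

omit h𝒦 in
/-- **The five generators are linearly independent** (read off the coordinates `1, Z, ⟨τ⟩, K, G`).
[cite: BartelDokchitser2015, §2 ("These are clearly linearly independent")] -/
theorem linearIndependent_basis_dihedralEight :
    LinearIndependent ℤ (![(![0, 0, 0, 0, 1, -1, -1, 1, 0, 0, 0] : Fin 11 → ℤ), ![0, 0, 0, 0, 0, 0, 1, -1, -1, 1, 0], ![0, 0, 1, -1, 0, 0, 0, 0, -1, -1, 2], ![0, 1, -1, 0, 0, 0, 0, -2, 0, 2, 0], ![1, -1, 0, 0, 0, -2, 0, 2, 0, 0, 0]] : Fin 5 → Fin 11 → ℤ) := by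
  rw [Fintype.linearIndependent_iff]
  intro c hc i
  have e0 := congr_fun hc 0
  have e4 := congr_fun hc 4
  have e10 := congr_fun hc 10
  have e1 := congr_fun hc 1
  have e6 := congr_fun hc 6
  simp [Fin.sum_univ_five] at e0 e4 e10 e1 e6
  fin_cases i <;> simp <;> omega

omit h𝒦 in
/-- **On the span of the six lifted and induced relations the functional `a_σ + a_K + a_D` is EVEN**, while it is
`−1` on `Θ_dih`: `Θ_dih` is NOT a combination of relations from proper subquotients — it is PRIMITIVE.
[cite: BartelDokchitser2015, §1.1 Theorem A (1) and Case 1] -/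
theorem thetaDih_not_mem_span_imprimitive_dihedralEight :
    (![0, 0, 0, 0, 1, -1, -1, 1, 0, 0, 0] : Fin 11 → ℤ) ∉ Submodule.span ℤ {(![0, 0, 0, 0, 0, 0, 1, -1, -1, 1, 0] : Fin 11 → ℤ), ![0, 0, 1, -1, 0, 0, 0, 0, -1, -1, 2], ![0, 1, -1, 0, 0, 0, -2, 0, 2, 0, 0],
      ![0, 1, -1, 0, 0, 0, 0, -2, 0, 2, 0], ![1, -1, 0, 0, -2, 0, 2, 0, 0, 0, 0], ![1, -1, 0, 0, 0, -2, 0, 2, 0, 0, 0]} := by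
  intro h
  have key : ∀ v ∈ Submodule.span ℤ {(![0, 0, 0, 0, 0, 0, 1, -1, -1, 1, 0] : Fin 11 → ℤ), ![0, 0, 1, -1, 0, 0, 0, 0, -1, -1, 2], ![0, 1, -1, 0, 0, 0, -2, 0, 2, 0, 0],
      ![0, 1, -1, 0, 0, 0, 0, -2, 0, 2, 0], ![1, -1, 0, 0, -2, 0, 2, 0, 0, 0, 0], ![1, -1, 0, 0, 0, -2, 0, 2, 0, 0, 0]}, (2 : ℤ) ∣ v 3 + v 6 + v 8 := by
    intro v hv
    refine Submodule.span_induction (p := fun v _ ↦ (2 : ℤ) ∣ v 3 + v 6 + v 8) ?_ ?_ ?_ ?_ hv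
    · intro w hw
      simp only [Set.mem_insert_iff, Set.mem_singleton_iff] at hw
      rcases hw with rfl | rfl | rfl | rfl | rfl | rfl <;> decide
    · simp
    · intro x y _ _ hx hy
      simp only [Pi.add_apply]
      obtain ⟨m, hm⟩ := hx
      obtain ⟨m', hm'⟩ := hy
      exact ⟨m + m', by linear_combination hm + hm'⟩
    · intro c x _ hx
      simp only [Pi.smul_apply, smul_eq_mul]
      obtain ⟨m, hm⟩ := hx
      exact ⟨c * m, by linear_combination c * hm⟩
  have h2 := key _ h
  revert h2
  decide

omit h𝒦 in
/-- **`2Θ_dih` IS in that span** (`= Ind_{K'} − Ind_K`). [cite: BartelDokchitser2015, §1.1 Theorem A Case 1 ("Prim(G) = ℤ/2ℤ")] -/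
theorem two_smul_thetaDih_mem_span_imprimitive_dihedralEight :
    (2 : ℤ) • (![0, 0, 0, 0, 1, -1, -1, 1, 0, 0, 0] : Fin 11 → ℤ) ∈ Submodule.span ℤ {(![0, 0, 0, 0, 0, 0, 1, -1, -1, 1, 0] : Fin 11 → ℤ), ![0, 0, 1, -1, 0, 0, 0, 0, -1, -1, 2], ![0, 1, -1, 0, 0, 0, -2, 0, 2, 0, 0],
      ![0, 1, -1, 0, 0, 0, 0, -2, 0, 2, 0], ![1, -1, 0, 0, -2, 0, 2, 0, 0, 0, 0], ![1, -1, 0, 0, 0, -2, 0, 2, 0, 0, 0]} := by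
  rw [two_smul_thetaDih_eq_dihedralEight]
  exact Submodule.sub_mem _ (Submodule.subset_span (by simp)) (Submodule.subset_span (by simp))

omit h𝒦 in
/-- The six imprimitive generators are relations: their span lies in `K(D_8)`. [cite: BartelDokchitser2015, §2; §5 Theorem 4] -/
theorem span_imprimitive_le_brauerRelations_dihedralEight
    (h𝒦 : ∀ a : Fin 11 → ℤ, a ∈ 𝒦 ↔ ∑ i : Fin 11, (a i : ℂ) • indClassFun ((![⊥, Subgroup.zpowers ((r 1 : DihedralGroup 8) ^ 4),
        Subgroup.zpowers ((r 1 : DihedralGroup 8) ^ 2), Subgroup.zpowers (r 1 : DihedralGroup 8),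
        Subgroup.zpowers (sr 0 : DihedralGroup 8), Subgroup.zpowers ((r 1 : DihedralGroup 8) * sr 0),
        Subgroup.zpowers (sr 0 : DihedralGroup 8) ⊔ Subgroup.zpowers ((r 1 : DihedralGroup 8) ^ 4),
        Subgroup.zpowers ((r 1 : DihedralGroup 8) * sr 0) ⊔ Subgroup.zpowers ((r 1 : DihedralGroup 8) ^ 4),
        Subgroup.zpowers (sr 0 : DihedralGroup 8) ⊔ Subgroup.zpowers ((r 1 : DihedralGroup 8) ^ 2),
        Subgroup.zpowers ((r 1 : DihedralGroup 8) * sr 0) ⊔ Subgroup.zpowers ((r 1 : DihedralGroup 8) ^ 2), ⊤] :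
        Fin 11 → Subgroup (DihedralGroup 8)) i) 1 = 0) :
    Submodule.span ℤ {(![0, 0, 0, 0, 0, 0, 1, -1, -1, 1, 0] : Fin 11 → ℤ), ![0, 0, 1, -1, 0, 0, 0, 0, -1, -1, 2], ![0, 1, -1, 0, 0, 0, -2, 0, 2, 0, 0],
      ![0, 1, -1, 0, 0, 0, 0, -2, 0, 2, 0], ![1, -1, 0, 0, -2, 0, 2, 0, 0, 0, 0], ![1, -1, 0, 0, 0, -2, 0, 2, 0, 0, 0]} ≤ 𝒦 := by
  refine Submodule.span_le.2 ?_
  rintro v (rfl | rfl | rfl | rfl | rfl | rfl)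
  · exact infDih_mem_brauerRelations_dihedralEight 𝒦 h𝒦
  · exact infKlein_mem_brauerRelations_dihedralEight 𝒦 h𝒦
  · exact infInd_mem_brauerRelations_dihedralEight 𝒦 h𝒦
  · exact infInd'_mem_brauerRelations_dihedralEight 𝒦 h𝒦
  · exact indKlein_mem_brauerRelations_dihedralEight 𝒦 h𝒦
  · exact indKlein'_mem_brauerRelations_dihedralEight 𝒦 h𝒦

/-- **`K(D_8) = ℤΘ_dih + Imprim`**: with the two previous theorems, `K(D_8)/Imprim ≅ ℤ/2ℤ` generated by the class of
`Θ_dih` — "`Prim(D_{2^n}) = ℤ/2ℤ`" for `2^n = 16`. [cite: BartelDokchitser2015, §1.1 Theorem A Case 1] -/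
theorem brauerRelations_dihedralEight_eq_span_thetaDih_sup_imprimitive :
    𝒦 = Submodule.span ℤ {(![0, 0, 0, 0, 1, -1, -1, 1, 0, 0, 0] : Fin 11 → ℤ)} ⊔ Submodule.span ℤ {(![0, 0, 0, 0, 0, 0, 1, -1, -1, 1, 0] : Fin 11 → ℤ), ![0, 0, 1, -1, 0, 0, 0, 0, -1, -1, 2], ![0, 1, -1, 0, 0, 0, -2, 0, 2, 0, 0],
      ![0, 1, -1, 0, 0, 0, 0, -2, 0, 2, 0], ![1, -1, 0, 0, -2, 0, 2, 0, 0, 0, 0], ![1, -1, 0, 0, 0, -2, 0, 2, 0, 0, 0]} := by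
  refine le_antisymm ?_ (sup_le ((Submodule.span_singleton_le_iff_mem _ _).2
    (thetaDih_mem_brauerRelations_dihedralEight 𝒦 h𝒦)) (span_imprimitive_le_brauerRelations_dihedralEight 𝒦 h𝒦))
  rw [brauerRelations_dihedralEight_eq_span 𝒦 h𝒦, Submodule.span_le]
  rintro v (rfl | rfl | rfl | rfl | rfl)
  · exact Submodule.mem_sup_left (Submodule.subset_span rfl)
  · exact Submodule.mem_sup_right (Submodule.subset_span (by simp))
  · exact Submodule.mem_sup_right (Submodule.subset_span (by simp))
  · exact Submodule.mem_sup_right (Submodule.subset_span (by simp))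
  · exact Submodule.mem_sup_right (Submodule.subset_span (by simp))

end DihedralEightLattice

/-- The canonical lattice `K(D_8) = ker(a ↦ Σ_i a_i (1_{H_i})^G)` is the span of the five generators.
[cite: BartelDokchitser2015, §1.1; §5 Theorem 4] -/
theorem ker_linearCombination_indClassFun_one_dihedralEight_eq_span :
    LinearMap.ker (Fintype.linearCombination ℤ fun i : Fin 11 ↦ indClassFun ((![⊥, Subgroup.zpowers ((r 1 : DihedralGroup 8) ^ 4),
        Subgroup.zpowers ((r 1 : DihedralGroup 8) ^ 2), Subgroup.zpowers (r 1 : DihedralGroup 8),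
        Subgroup.zpowers (sr 0 : DihedralGroup 8), Subgroup.zpowers ((r 1 : DihedralGroup 8) * sr 0),
        Subgroup.zpowers (sr 0 : DihedralGroup 8) ⊔ Subgroup.zpowers ((r 1 : DihedralGroup 8) ^ 4),
        Subgroup.zpowers ((r 1 : DihedralGroup 8) * sr 0) ⊔ Subgroup.zpowers ((r 1 : DihedralGroup 8) ^ 4),
        Subgroup.zpowers (sr 0 : DihedralGroup 8) ⊔ Subgroup.zpowers ((r 1 : DihedralGroup 8) ^ 2),
        Subgroup.zpowers ((r 1 : DihedralGroup 8) * sr 0) ⊔ Subgroup.zpowers ((r 1 : DihedralGroup 8) ^ 2), ⊤] :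
        Fin 11 → Subgroup (DihedralGroup 8)) i) 1) =
      Submodule.span ℤ {(![0, 0, 0, 0, 1, -1, -1, 1, 0, 0, 0] : Fin 11 → ℤ), ![0, 0, 0, 0, 0, 0, 1, -1, -1, 1, 0], ![0, 0, 1, -1, 0, 0, 0, 0, -1, -1, 2], ![0, 1, -1, 0, 0, 0, 0, -2, 0, 2, 0], ![1, -1, 0, 0, 0, -2, 0, 2, 0, 0, 0]} :=
  brauerRelations_dihedralEight_eq_span _ (mem_ker_linearCombination_indClassFun_one_iff _)

/-- **`rank K(D_8) = 5`** (on the canonical lattice) — the number of conjugacy classes of non-cyclic subgroups: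
`K, K', D, D', D_8`. [cite: BartelDokchitser2015, §2] -/
theorem finrank_ker_linearCombination_indClassFun_one_dihedralEight :
    Module.finrank ℤ (LinearMap.ker (Fintype.linearCombination ℤ fun i : Fin 11 ↦ indClassFun ((![⊥, Subgroup.zpowers ((r 1 : DihedralGroup 8) ^ 4),
        Subgroup.zpowers ((r 1 : DihedralGroup 8) ^ 2), Subgroup.zpowers (r 1 : DihedralGroup 8),
        Subgroup.zpowers (sr 0 : DihedralGroup 8), Subgroup.zpowers ((r 1 : DihedralGroup 8) * sr 0),
        Subgroup.zpowers (sr 0 : DihedralGroup 8) ⊔ Subgroup.zpowers ((r 1 : DihedralGroup 8) ^ 4),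
        Subgroup.zpowers ((r 1 : DihedralGroup 8) * sr 0) ⊔ Subgroup.zpowers ((r 1 : DihedralGroup 8) ^ 4),
        Subgroup.zpowers (sr 0 : DihedralGroup 8) ⊔ Subgroup.zpowers ((r 1 : DihedralGroup 8) ^ 2),
        Subgroup.zpowers ((r 1 : DihedralGroup 8) * sr 0) ⊔ Subgroup.zpowers ((r 1 : DihedralGroup 8) ^ 2), ⊤] :
        Fin 11 → Subgroup (DihedralGroup 8)) i) 1)) = 5 := by
  rw [ker_linearCombination_indClassFun_one_dihedralEight_eq_span]
  have h := linearIndependent_basis_dihedralEight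
  rw [show ({(![0, 0, 0, 0, 1, -1, -1, 1, 0, 0, 0] : Fin 11 → ℤ), ![0, 0, 0, 0, 0, 0, 1, -1, -1, 1, 0], ![0, 0, 1, -1, 0, 0, 0, 0, -1, -1, 2], ![0, 1, -1, 0, 0, 0, 0, -2, 0, 2, 0], ![1, -1, 0, 0, 0, -2, 0, 2, 0, 0, 0]} : Set (Fin 11 → ℤ)) =
      Set.range (![(![0, 0, 0, 0, 1, -1, -1, 1, 0, 0, 0] : Fin 11 → ℤ), ![0, 0, 0, 0, 0, 0, 1, -1, -1, 1, 0], ![0, 0, 1, -1, 0, 0, 0, 0, -1, -1, 2], ![0, 1, -1, 0, 0, 0, 0, -2, 0, 2, 0], ![1, -1, 0, 0, 0, -2, 0, 2, 0, 0, 0]] : Fin 5 → Fin 11 → ℤ) by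
    ext v
    simp only [Set.mem_insert_iff, Set.mem_singleton_iff, Set.mem_range]
    constructor
    · rintro (rfl | rfl | rfl | rfl | rfl)
      exacts [⟨0, rfl⟩, ⟨1, rfl⟩, ⟨2, rfl⟩, ⟨3, rfl⟩, ⟨4, rfl⟩]
    · rintro ⟨i, rfl⟩
      fin_cases i <;> simp]
  rw [finrank_span_eq_card h, Fintype.card_fin]

/-! ## §5 The Kani–Rosen isogeny of the lifted dihedral relation: `B_K × B_{D'} ∼ B_{K'} × B_D` -/

section DihedralEightIsogeny

/-- **`(1_K)^G + (1_{D'})^G = (1_{K'})^G + (1_D)^G`** — the lift of `D_4`'s dihedral relation, as permutation characters.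
[cite: BartelDokchitser2015, §2 (Inflation); §5 Theorem 4 (3)] -/
theorem indClassFun_kleinTau_add_dihedralMul_eq_dihedralEight :
    indClassFun (Subgroup.zpowers (sr 0 : DihedralGroup 8) ⊔ Subgroup.zpowers ((r 1 : DihedralGroup 8) ^ 4)) 1 +
        indClassFun (Subgroup.zpowers ((r 1 : DihedralGroup 8) * sr 0) ⊔ Subgroup.zpowers ((r 1 : DihedralGroup 8) ^ 2)) 1 =
      indClassFun (Subgroup.zpowers ((r 1 : DihedralGroup 8) * sr 0) ⊔ Subgroup.zpowers ((r 1 : DihedralGroup 8) ^ 4)) 1 +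
        indClassFun (Subgroup.zpowers (sr 0 : DihedralGroup 8) ⊔ Subgroup.zpowers ((r 1 : DihedralGroup 8) ^ 2)) 1 := by
  funext g
  obtain ⟨-, -, -, -, -, -, h6, h7, h8, h9, -⟩ := indClassFun_one_apply_dihedralEight g
  simp only [Pi.add_apply]
  rw [h6, h7, h8, h9]
  rcases dihedralGroup_eight_cases g with rfl | rfl | (rfl | rfl) | (rfl | rfl | rfl | rfl) |
      (rfl | rfl | rfl | rfl) | (rfl | rfl | rfl | rfl) <;>
    simp (config := { decide := true }) only [if_true, if_false] <;> norm_num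

variable {K : Type u} [Field K] {X : AbelianVariety K} (ρ : DihedralGroup 8 →* End X)

/-- From a two-plus-two identity of permutation characters to Hom counts. [cite: KaniRosen1989, Thm. 3] [cite: BartelDokchitser2015, §1.1] -/
private theorem finrank_hom_add_eq_of_indClassFun_add_eq_d8 {A A' B₁ B₁' : Subgroup (DihedralGroup 8)} [Fintype A]
    [Fintype A'] [Fintype B₁] [Fintype B₁'] {NA NA' NB NB' : X ⟶ X}
    (h : indClassFun A (1 : A → ℂ) + indClassFun B₁' (1 : B₁' → ℂ) = indClassFun A' (1 : A' → ℂ) + indClassFun B₁ (1 : B₁ → ℂ))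
    (hNA : End.of NA = ∑ x : A, ρ x) (hNA' : End.of NA' = ∑ x : A', ρ x) (hNB : End.of NB = ∑ x : B₁, ρ x)
    (hNB' : End.of NB' = ∑ x : B₁', ρ x) (B : AbelianVariety K) :
    Module.finrank ℤ (image NA ⟶ B) + Module.finrank ℤ (image NB' ⟶ B) =
      Module.finrank ℤ (image NA' ⟶ B) + Module.finrank ℤ (image NB ⟶ B) := by
  classical
  have key := sum_mul_finrank_hom_eq_of_sum_smul_indClassFun_one_eq ρ (![A, B₁'] : Fin 2 → Subgroup (DihedralGroup 8))
    (![A', B₁] : Fin 2 → Subgroup (DihedralGroup 8)) (N := ![NA, NB']) (N' := ![NA', NB]) (fun _ ↦ 1) (fun _ ↦ 1)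
    (by
      simp only [Fin.sum_univ_two, Nat.cast_one, one_smul]
      convert h <;> rfl)
    (Fin.forall_fin_two.2 ⟨by convert hNA <;> rfl, by convert hNB' <;> rfl⟩)
    (Fin.forall_fin_two.2 ⟨by convert hNA' <;> rfl, by convert hNB <;> rfl⟩) B
  simp only [Fin.sum_univ_two, Matrix.cons_val_zero, Matrix.cons_val_one, one_mul] at key
  convert key using 2 <;> rfl

/-- **Hom counts of the lifted dihedral relation** (any field): `rk Hom(B_K, B) + rk Hom(B_{D'}, B) =
rk Hom(B_{K'}, B) + rk Hom(B_D, B)`. [cite: KaniRosen1989, Thm. 3] [cite: BartelDokchitser2015, §2 (Inflation); §5 Theorem 4 (3)] -/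
theorem finrank_hom_infDih_dihedralEight
    [Fintype ↥(Subgroup.zpowers (sr 0 : DihedralGroup 8) ⊔ Subgroup.zpowers ((r 1 : DihedralGroup 8) ^ 4))]
    [Fintype ↥(Subgroup.zpowers ((r 1 : DihedralGroup 8) * sr 0) ⊔ Subgroup.zpowers ((r 1 : DihedralGroup 8) ^ 4))]
    [Fintype ↥(Subgroup.zpowers (sr 0 : DihedralGroup 8) ⊔ Subgroup.zpowers ((r 1 : DihedralGroup 8) ^ 2))]
    [Fintype ↥(Subgroup.zpowers ((r 1 : DihedralGroup 8) * sr 0) ⊔ Subgroup.zpowers ((r 1 : DihedralGroup 8) ^ 2))]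
    {NK NK' ND ND' : X ⟶ X}
    (hNK : End.of NK = ∑ x : ↥(Subgroup.zpowers (sr 0 : DihedralGroup 8) ⊔ Subgroup.zpowers ((r 1 : DihedralGroup 8) ^ 4)), ρ x)
    (hNK' : End.of NK' = ∑ x : ↥(Subgroup.zpowers ((r 1 : DihedralGroup 8) * sr 0) ⊔
      Subgroup.zpowers ((r 1 : DihedralGroup 8) ^ 4)), ρ x)
    (hND : End.of ND = ∑ x : ↥(Subgroup.zpowers (sr 0 : DihedralGroup 8) ⊔ Subgroup.zpowers ((r 1 : DihedralGroup 8) ^ 2)), ρ x)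
    (hND' : End.of ND' = ∑ x : ↥(Subgroup.zpowers ((r 1 : DihedralGroup 8) * sr 0) ⊔
      Subgroup.zpowers ((r 1 : DihedralGroup 8) ^ 2)), ρ x) (B : AbelianVariety K) :
    Module.finrank ℤ (image NK ⟶ B) + Module.finrank ℤ (image ND' ⟶ B) =
      Module.finrank ℤ (image NK' ⟶ B) + Module.finrank ℤ (image ND ⟶ B) :=
  finrank_hom_add_eq_of_indClassFun_add_eq_d8 ρ indClassFun_kleinTau_add_dihedralMul_eq_dihedralEight hNK hNK' hND hND' B

variable [PerfectField K]

/-- **`B_K × B_{D'} ∼ B_{K'} × B_D` over a perfect field** — the Kani–Rosen isogeny of the relation lifted from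
`D_8/Z ≅ D_4` (for curves: `J_{C/K} × J_{C/D'} ∼ J_{C/K'} × J_{C/D}`); the isogeny of `Θ_dih` itself is g28-#1's
`dihedralGroup_isIsogenous_centralKlein 2`. [cite: KaniRosen1989, Thm. 3] [cite: BartelDokchitser2015, §5 Theorem 4 (3)] [cite: DokchitserEtAl2022, §1.3 Thm. 1.3] -/
theorem isIsogenous_infDih_dihedralEight
    [Fintype ↥(Subgroup.zpowers (sr 0 : DihedralGroup 8) ⊔ Subgroup.zpowers ((r 1 : DihedralGroup 8) ^ 4))]
    [Fintype ↥(Subgroup.zpowers ((r 1 : DihedralGroup 8) * sr 0) ⊔ Subgroup.zpowers ((r 1 : DihedralGroup 8) ^ 4))]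
    [Fintype ↥(Subgroup.zpowers (sr 0 : DihedralGroup 8) ⊔ Subgroup.zpowers ((r 1 : DihedralGroup 8) ^ 2))]
    [Fintype ↥(Subgroup.zpowers ((r 1 : DihedralGroup 8) * sr 0) ⊔ Subgroup.zpowers ((r 1 : DihedralGroup 8) ^ 2))]
    {NK NK' ND ND' : X ⟶ X}
    (hNK : End.of NK = ∑ x : ↥(Subgroup.zpowers (sr 0 : DihedralGroup 8) ⊔ Subgroup.zpowers ((r 1 : DihedralGroup 8) ^ 4)), ρ x)
    (hNK' : End.of NK' = ∑ x : ↥(Subgroup.zpowers ((r 1 : DihedralGroup 8) * sr 0) ⊔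
      Subgroup.zpowers ((r 1 : DihedralGroup 8) ^ 4)), ρ x)
    (hND : End.of ND = ∑ x : ↥(Subgroup.zpowers (sr 0 : DihedralGroup 8) ⊔ Subgroup.zpowers ((r 1 : DihedralGroup 8) ^ 2)), ρ x)
    (hND' : End.of ND' = ∑ x : ↥(Subgroup.zpowers ((r 1 : DihedralGroup 8) * sr 0) ⊔
      Subgroup.zpowers ((r 1 : DihedralGroup 8) ^ 2)), ρ x) :
    IsIsogenous (image NK ⊞ image ND') (image NK' ⊞ image ND) := by
  refine isIsogenous_iff_forall_finrank_hom_eq'.2 fun B ↦ ?_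
  rw [finrank_hom_biprod, finrank_hom_biprod]
  exact finrank_hom_infDih_dihedralEight ρ hNK hNK' hND hND' B

/-- Dimensions: `dim B_K + dim B_{D'} = dim B_{K'} + dim B_D`. [cite: KaniRosen1989, Thm. 3] [cite: BartelDokchitser2015, §5 Theorem 4 (3)] -/
theorem dim_infDih_dihedralEight
    [Fintype ↥(Subgroup.zpowers (sr 0 : DihedralGroup 8) ⊔ Subgroup.zpowers ((r 1 : DihedralGroup 8) ^ 4))]
    [Fintype ↥(Subgroup.zpowers ((r 1 : DihedralGroup 8) * sr 0) ⊔ Subgroup.zpowers ((r 1 : DihedralGroup 8) ^ 4))]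
    [Fintype ↥(Subgroup.zpowers (sr 0 : DihedralGroup 8) ⊔ Subgroup.zpowers ((r 1 : DihedralGroup 8) ^ 2))]
    [Fintype ↥(Subgroup.zpowers ((r 1 : DihedralGroup 8) * sr 0) ⊔ Subgroup.zpowers ((r 1 : DihedralGroup 8) ^ 2))]
    {NK NK' ND ND' : X ⟶ X}
    (hNK : End.of NK = ∑ x : ↥(Subgroup.zpowers (sr 0 : DihedralGroup 8) ⊔ Subgroup.zpowers ((r 1 : DihedralGroup 8) ^ 4)), ρ x)
    (hNK' : End.of NK' = ∑ x : ↥(Subgroup.zpowers ((r 1 : DihedralGroup 8) * sr 0) ⊔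
      Subgroup.zpowers ((r 1 : DihedralGroup 8) ^ 4)), ρ x)
    (hND : End.of ND = ∑ x : ↥(Subgroup.zpowers (sr 0 : DihedralGroup 8) ⊔ Subgroup.zpowers ((r 1 : DihedralGroup 8) ^ 2)), ρ x)
    (hND' : End.of ND' = ∑ x : ↥(Subgroup.zpowers ((r 1 : DihedralGroup 8) * sr 0) ⊔
      Subgroup.zpowers ((r 1 : DihedralGroup 8) ^ 2)), ρ x) :
    (image NK).dim + (image ND').dim = (image NK').dim + (image ND).dim := by
  have h := (isIsogenous_infDih_dihedralEight ρ hNK hNK' hND hND').dim_eq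
  rwa [dim_biprod, dim_biprod] at h

end DihedralEightIsogeny

end AbelianVariety

end Literature.AlgebraicGeometry.Motives
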